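import Summits.AtomisticToContinuum.Crystallization.Theses.PricedLinkCensus

/-!
# Disproof of `SoftLayerPropagation` (crux stmt-AtomisticToContinuum-14233, route PricedLinkCensus) — findings

Standing disprover's work file (refuter-cdisprove-stmt-AtomisticToContinuum-14233-0).  Prose lives in
docstrings only; everything not marked `sorry` is checked.

## Index

* §0 `SLP ρ R τ` — the crux with its three geometric constants made parameters (hypothesis radius `ρ`,
  conclusion radius `R`, matching tolerance `τ`, all in units of `nn_i`); `softLayerPropagation_iff :
  SoftLayerPropagation ↔ SLP 8 3 (1/6)`.
* §1 COUNTING (both-ways matching forces local Barlow density): `le_card_of_barlowMatched` — if the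
  centre is `a/6`-close to `g z₀` and every Barlow point within `3a` of the centre is `a/6`-close to a
  site, then `85 ≤ N` (the `31 + 27 + 27` points of the layers `k, k ± 1` of `z₀` within `√7·a`).
* §2 INTEGER CERTIFICATES: configurations `c • intVec (T j)` with an integer table `T`; the scale-free
  bond graph at `η = 1/100` is the decidable integer relation `10000·|T j − T k|² ≤ 10201·min(m_j, m_k)`
  (`bondGraph_cfg_adj`), so `IsChargeFree (1/100)` of an explicit cluster is `decide`d
  (`isChargeFree_cfg_iff`).
* §3 LOAD-BEARING HYPOTHESES: `softLayerPropagation_false_without_ball` (`¬ SLP 0 3 (1/6)`: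
  charge-freeness of the centre alone — the 13-point cuboctahedral cluster `T13` — does not give the
  conclusion) and `softLayerPropagation_false_radius_threeHalves` (`¬ SLP (3/2) 3 (1/6)`: nor does
  charge-freeness of everything within `1.5·nn` — the 79-point fcc cluster `T79`; `SLP.mono` gives all
  `ρ ≤ 3/2`).  Any proof must use charge-free sites beyond the second neighbours; the counting method
  (`85` Barlow points) cannot reach `ρ = 2`.
* §4 (emptied) — the v3 near-miss is now the theorem of §6.  Kit job j005226 findings live in the
  docstrings: NON-VACUITY (fcc/hcp/dhcp/random Barlow balls: all `≈ 3050` sites within `8·nn`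
  charge-free at `η = 1/100`, exact integer arithmetic for fcc); strain table (z-stretch `1.98 %` →
  deviation `0.056`, `2.05 %` → charged; `[110]` `0.95 %` → `0.024`; `[111]` `1.48 %` → `0.036`; hcp
  `c/a` `±1.5 %` → `≤ 0.036`); the T-junction family reaches charge-free radius `2√2` at most
  (foreign layers need the twin plane within `3 − h` of the centre).
* §5 TIGHTNESS of the tolerance: `softLayerPropagation_tolerance_lb : ¬ SLP 8 3 (1/20)` — fcc under
  uniform `1.99 %` cube-axis strain is charge-free everywhere at `η = 1/100` (5979-site certificate,
  `native_decide`) and its `3·nn`-ball is not `nn/20`-matchable to any Barlow stacking (a chain of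
  four forced `√2·nn` steps, `barlow_dist_sq_trichotomy`).  So `τ` cannot be taken below
  `≈ 0.056·nn`: the rigidity constant the provers need lies in `[1.9, 5.6)`.
* §6 RADIUS via the double-twin T-junction: `softLayerPropagation_false_radius_twin :
  ¬ SLP (14/5) 3 (1/6)` — three fcc grains pairwise twinned across `{x+y+z=0}` and `{x+y−z=0}`
  (723-site certificate, `native_decide`): every site within `2.8·nn` of the centre is charge-free,
  but the `3·nn`-ball contains two bipyramids (face-sharing tetrahedra) with axes at `109.5°`, and
  `barlow_bipyramid_vertical` (face-sharing tetrahedra of a Barlow stacking are stacked along `e₃`;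
  Barlow coordinates + `decide`) with the forcing lemma `barlow_dist_eq_a` makes an `nn/6`-matching
  impossible (numerically the deviation is `0.296·nn`, kit job j013730).  With `SLP.mono`: the
  charge-free ball of the crux must have radius `> 2.8·nn`; the topological part needs `≈ 3 + h`,
  so the crux's `ρ = 8` keeps `≈ 4·nn` of slack, while `τ = 1/6` keeps a factor `≈ 3` over the
  best strain witness (LP search for the true worst case: kit jobs j005229/j014605/j014606).
-/

noncomputable section

namespace Summit.AtomisticToContinuum.Crystallization.Cruxes.SoftLayerPropagation.Disproof

open Literature.Geometry.DiscreteGeometry Literature.MathematicalPhysics.StatisticalMechanics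
open Summit.AtomisticToContinuum.Crystallization.Theses.PricedLinkCensus

/-- Euclidean `3`-space. -/
local notation "E3" => EuclideanSpace ℝ (Fin 3)

/-! ## §0 The crux with parameters -/

/-- `SLP ρ R τ`: the crux `SoftLayerPropagation` with hypothesis radius `ρ`, conclusion radius `R` and
matching tolerance `τ` (all in units of the centre's nearest-neighbour distance).  The crux is
`SLP 8 3 (1/6)` (`softLayerPropagation_iff`). -/
def SLP (ρ R τ : ℝ) : Prop :=
  ∀ η : ℝ, 0 < η → η ≤ 1 / 100 → ∀ (N : ℕ) (y : Fin N → E3) (i : Fin N),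
    (∀ j : Fin N, dist (y i) (y j) ≤ ρ * nearestDist y i → IsChargeFree η y j) →
    ∃ (s : ℤ → ℤ) (g : E3 ≃ᵃⁱ[ℝ] E3), IsHaggSeq s ∧
      (∀ j : Fin N, dist (y i) (y j) ≤ R * nearestDist y i →
        ∃ z ∈ barlowStacking (nearestDist y i) (nearestDist y i * Real.sqrt (2 / 3)) s,
          dist (y j) (g z) ≤ τ * nearestDist y i) ∧
      ∀ z ∈ barlowStacking (nearestDist y i) (nearestDist y i * Real.sqrt (2 / 3)) s,
        dist (y i) (g z) ≤ R * nearestDist y i → ∃ j : Fin N, dist (y j) (g z) ≤ τ * nearestDist y i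

/-- The crux is `SLP 8 3 (1/6)` (the only difference is `nn/6` versus `(1/6)·nn`). -/
theorem softLayerPropagation_iff : SoftLayerPropagation ↔ SLP 8 3 (1 / 6) := by
  unfold SoftLayerPropagation SLP
  simp only [one_div, inv_mul_eq_div]

/-! ## §1 Counting: a both-ways `a/6`-matching sees at least `85` Barlow points -/

section Counting

variable (a h : ℝ) (s : ℤ → ℤ)

/-- In-layer squared distances of a Barlow stacking: `a² (Δi² + Δi Δj + Δj²)`. -/
theorem dist_sq_sameLayer (k i j i' j' : ℤ) :
    dist (barlowPos a h s k i j) (barlowPos a h s k i' j') ^ 2 =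
      a ^ 2 * (((i - i') ^ 2 + (i - i') * (j - j') + (j - j') ^ 2 : ℤ) : ℝ) := by
  rw [dist_barlowPos_sq]
  have h3 : (Real.sqrt 3 : ℝ) ^ 2 = 3 := Real.sq_sqrt (by norm_num)
  push_cast
  linear_combination (a ^ 2 * ((j : ℝ) - j') ^ 2 / 4) * h3

/-- Squared distances between consecutive layers `k + 1`, `k` of a Barlow stacking (Hägg sign `s k`):
`a² (Δi² + Δi Δj + Δj² + s_k (Δi + Δj)) + (a²/3 + h²)`. -/
theorem dist_sq_succLayer {s : ℤ → ℤ} (hs : IsHaggSeq s) (k i j i' j' : ℤ) :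
    dist (barlowPos a h s (k + 1) i j) (barlowPos a h s k i' j') ^ 2 =
      a ^ 2 * (((i - i') ^ 2 + (i - i') * (j - j') + (j - j') ^ 2 + s k * ((i - i') + (j - j')) : ℤ) : ℝ)
        + (a ^ 2 / 3 + h ^ 2) := by
  rw [dist_barlowPos_sq, haggLabel_succ]
  have h3 : (Real.sqrt 3 : ℝ) ^ 2 = 3 := Real.sq_sqrt (by norm_num)
  rcases hs k with hk | hk <;> rw [hk] <;> push_cast
  · linear_combination (a ^ 2 * ((j : ℝ) - j' + 1 / 3) ^ 2 / 4) * h3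
  · linear_combination (a ^ 2 * ((j : ℝ) - j' - 1 / 3) ^ 2 / 4) * h3

/-- The triangular form. -/
def Qf (di dj : ℤ) : ℤ := di ^ 2 + di * dj + dj ^ 2

/-- The `85` offsets `(dk, di, dj)` of the points of layers `k, k+1, k-1` within `√7·a` of
`barlowPos k i₀ j₀`, given the Hägg signs `σp = s k` and `σm = s (k-1)`. -/
def offsets (σp σm : ℤ) : Finset (ℤ × ℤ × ℤ) :=
  (Finset.Icc (-1 : ℤ) 1 ×ˢ (Finset.Icc (-3 : ℤ) 3 ×ˢ Finset.Icc (-3 : ℤ) 3)).filter fun d =>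
    (d.1 = 0 → Qf d.2.1 d.2.2 ≤ 7) ∧ (d.1 = 1 → Qf d.2.1 d.2.2 + σp * (d.2.1 + d.2.2) + 1 ≤ 7) ∧
      (d.1 = -1 → Qf d.2.1 d.2.2 - σm * (d.2.1 + d.2.2) + 1 ≤ 7)

/-- There are `85` offsets for every choice of the two Hägg signs. -/
theorem card_offsets (σp σm : ℤ) (hp : σp = 1 ∨ σp = -1) (hm : σm = 1 ∨ σm = -1) :
    (offsets σp σm).card = 85 := by
  rcases hp with rfl | rfl <;> rcases hm with rfl | rfl <;> decide


/-- Layer `k - 1` seen from layer `k`. -/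
theorem dist_sq_predLayer {s : ℤ → ℤ} (hs : IsHaggSeq s) (k i j i' j' : ℤ) :
    dist (barlowPos a h s k i j) (barlowPos a h s (k - 1) i' j') ^ 2 =
      a ^ 2 * (((i - i') ^ 2 + (i - i') * (j - j') + (j - j') ^ 2 + s (k - 1) * ((i - i') + (j - j')) : ℤ) : ℝ)
        + (a ^ 2 / 3 + h ^ 2) := by
  have := dist_sq_succLayer a h hs (k - 1) i j i' j'
  rwa [sub_add_cancel] at this

variable {a}

/-- **Counting lemma.** If the centre `y i` is `a/6`-close to the image `g z₀` of a Barlow point and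
every Barlow point whose image is within `3a` of `y i` is `a/6`-close to some site (clause 2 of the
crux with `R = 3`, `τ = 1/6`), then the configuration has at least `85` sites: the `31 + 27 + 27`
points of the layers `k`, `k + 1`, `k - 1` of `z₀` within `√7·a ≤ (3 - 1/6)a` of `z₀` are claimed by
pairwise distinct sites (two Barlow points sharing a site would be `≤ a/3 < min a h` apart). -/
theorem le_card_of_barlowMatched {N : ℕ} (y : Fin N → E3) (i : Fin N) (ha : 0 < a)
    {s : ℤ → ℤ} (hs : IsHaggSeq s) (g : E3 ≃ᵃⁱ[ℝ] E3)
    (h1 : ∃ z ∈ barlowStacking a (a * Real.sqrt (2 / 3)) s, dist (y i) (g z) ≤ a / 6)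
    (h2 : ∀ z ∈ barlowStacking a (a * Real.sqrt (2 / 3)) s, dist (y i) (g z) ≤ 3 * a →
      ∃ j : Fin N, dist (y j) (g z) ≤ a / 6) :
    85 ≤ N := by
  classical
  set h := a * Real.sqrt (2 / 3) with hh_def
  have hsq23 : Real.sqrt (2 / 3) ^ 2 = 2 / 3 := Real.sq_sqrt (by norm_num)
  have hh2 : h ^ 2 = 2 * a ^ 2 / 3 := by rw [hh_def, mul_pow, hsq23]; ring
  have hhpos : 0 < h := by positivity
  have hmin : a / 3 < min a h := by
    refine lt_min (by linarith) ?_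
    have hlt : (a / 3) ^ 2 < h ^ 2 := by rw [hh2]; nlinarith [mul_pos ha ha]
    exact lt_of_pow_lt_pow_left₀ 2 hhpos.le hlt
  obtain ⟨z₀, ⟨k, i₀, j₀, rfl⟩, hz₀⟩ := h1
  set D := offsets (s k) (s (k - 1)) with hD
  let F : ℤ × ℤ × ℤ → E3 := fun d => barlowPos a h s (k + d.1) (i₀ + d.2.1) (j₀ + d.2.2)
  have hF_mem : ∀ d, F d ∈ barlowStacking a h s := fun d => barlowPos_mem _ _ _
  have hF_dist : ∀ d ∈ D, dist (barlowPos a h s k i₀ j₀) (F d) ^ 2 ≤ 7 * a ^ 2 := by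
    rintro ⟨dk, di, dj⟩ hd
    simp only [hD, offsets, Finset.mem_filter, Finset.mem_product, Finset.mem_Icc] at hd
    obtain ⟨⟨⟨hk1, hk2⟩, -, -⟩, h0, hp1, hm1⟩ := hd
    have ha2 : 0 ≤ a ^ 2 := sq_nonneg a
    have hk : dk = 0 ∨ dk = 1 ∨ dk = -1 := by omega
    rcases hk with rfl | rfl | rfl
    · have e0 : F (0, di, dj) = barlowPos a h s k (i₀ + di) (j₀ + dj) := by simp [F]
      rw [e0, dist_sq_sameLayer]
      have hq : ((i₀ - (i₀ + di)) ^ 2 + (i₀ - (i₀ + di)) * (j₀ - (j₀ + dj)) + (j₀ - (j₀ + dj)) ^ 2 : ℤ)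
          = Qf di dj := by unfold Qf; ring
      rw [hq]
      have h7 : ((Qf di dj : ℤ) : ℝ) ≤ 7 := by exact_mod_cast h0 rfl
      nlinarith
    · have e1 : F (1, di, dj) = barlowPos a h s (k + 1) (i₀ + di) (j₀ + dj) := rfl
      rw [e1, dist_comm, dist_sq_succLayer a h hs]
      have hq : (((i₀ + di - i₀) ^ 2 + (i₀ + di - i₀) * (j₀ + dj - j₀) + (j₀ + dj - j₀) ^ 2 +
          s k * ((i₀ + di - i₀) + (j₀ + dj - j₀))) : ℤ) = Qf di dj + s k * (di + dj) := by unfold Qf; ring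
      rw [hq]
      have h7 : ((Qf di dj + s k * (di + dj) : ℤ) : ℝ) ≤ 6 := by
        have := hp1 rfl; exact_mod_cast (by omega : Qf di dj + s k * (di + dj) ≤ 6)
      nlinarith
    · have em : F (-1, di, dj) = barlowPos a h s (k - 1) (i₀ + di) (j₀ + dj) := rfl
      rw [em, dist_sq_predLayer a h hs]
      have hq : (((i₀ - (i₀ + di)) ^ 2 + (i₀ - (i₀ + di)) * (j₀ - (j₀ + dj)) + (j₀ - (j₀ + dj)) ^ 2 +
          s (k - 1) * ((i₀ - (i₀ + di)) + (j₀ - (j₀ + dj)))) : ℤ) = Qf di dj - s (k - 1) * (di + dj) := by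
        unfold Qf; ring
      rw [hq]
      have h7 : ((Qf di dj - s (k - 1) * (di + dj) : ℤ) : ℝ) ≤ 6 := by
        have := hm1 rfl; exact_mod_cast (by omega : Qf di dj - s (k - 1) * (di + dj) ≤ 6)
      nlinarith
  have hR : ∀ d ∈ D, dist (y i) (g (F d)) ≤ 3 * a := by
    intro d hd
    have h7 : dist (barlowPos a h s k i₀ j₀) (F d) ≤ 17 * a / 6 := by
      have hsq : dist (barlowPos a h s k i₀ j₀) (F d) ^ 2 ≤ (17 * a / 6) ^ 2 :=
        (hF_dist d hd).trans (by nlinarith [mul_pos ha ha])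
      exact (pow_le_pow_iff_left₀ dist_nonneg (by positivity) two_ne_zero).1 hsq
    calc dist (y i) (g (F d))
        ≤ dist (y i) (g (barlowPos a h s k i₀ j₀)) + dist (g (barlowPos a h s k i₀ j₀)) (g (F d)) :=
          dist_triangle _ _ _
      _ ≤ a / 6 + 17 * a / 6 := add_le_add hz₀ (by rw [g.dist_map]; exact h7)
      _ = 3 * a := by ring
  let φ : ℤ × ℤ × ℤ → Fin N := fun d =>
    if hd : d ∈ D then (h2 (F d) (hF_mem d) (hR d hd)).choose else i
  have hφ : ∀ d ∈ D, dist (y (φ d)) (g (F d)) ≤ a / 6 := by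
    intro d hd
    simp only [φ, dif_pos hd]
    exact (h2 (F d) (hF_mem d) (hR d hd)).choose_spec
  have hinj : Set.InjOn φ D := by
    intro d hd d' hd' heq
    have hclose : dist (F d) (F d') ≤ a / 3 := by
      rw [← g.dist_map]
      calc dist (g (F d)) (g (F d'))
          ≤ dist (g (F d)) (y (φ d)) + dist (y (φ d)) (g (F d')) := dist_triangle _ _ _
        _ ≤ a / 6 + a / 6 := add_le_add (by rw [dist_comm]; exact hφ d hd) (by rw [heq]; exact hφ d' hd')
        _ = a / 3 := by ring
    by_contra hne
    have hne' : (k + d.1, i₀ + d.2.1, j₀ + d.2.2) ≠ (k + d'.1, i₀ + d'.2.1, j₀ + d'.2.2) := by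
      intro e
      simp only [Prod.mk.injEq, add_right_inj] at e
      exact hne (Prod.ext e.1 (Prod.ext e.2.1 e.2.2))
    have hle := le_dist_barlowPos a h s ha.le hhpos.le hne'
    change min a h ≤ dist (F d) (F d') at hle
    linarith
  have hcard : D.card ≤ (Finset.univ : Finset (Fin N)).card :=
    Finset.card_le_card_of_injOn φ (fun d _ => Finset.mem_coe.2 (Finset.mem_univ (φ d))) hinj
  rw [Finset.card_univ, Fintype.card_fin, hD, card_offsets _ _ (hs k) (hs (k - 1))] at hcard
  exact hcard

end Counting

/-! ## §2 Integer certificates for the scale-free bond graph at `η = 1/100` -/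

section IntCert

variable {N : ℕ}

/-- The configuration `j ↦ c • intVec (T j)` of an integer coordinate table `T`. -/
def cfg (c : ℝ) (T : Fin N → Fin 3 → ℤ) : Fin N → E3 := fun j => c • intVec (T j)

/-- Distances in `cfg c T` are `|c|·√(integer squared distance)`. -/
theorem dist_cfg (c : ℝ) (T : Fin N → Fin 3 → ℤ) (j k : Fin N) :
    dist (cfg c T j) (cfg c T k) = |c| * Real.sqrt (sqNormInt (T j - T k) : ℝ) := by
  simp only [cfg]
  rw [dist_eq_norm, ← smul_sub, intVec_sub, norm_smul, Real.norm_eq_abs, norm_intVec]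

/-- Integer squared norms are nonnegative. -/
theorem sqNormInt_nonneg (v : Fin 3 → ℤ) : 0 ≤ sqNormInt v := by
  unfold sqNormInt; positivity

/-- `|v − w|² = |w − v|²`. -/
theorem sqNormInt_sub_comm (v w : Fin 3 → ℤ) : sqNormInt (v - w) = sqNormInt (w - v) := by
  unfold sqNormInt; simp only [Pi.sub_apply]; ring

/-- `IsMinSq T m`: `m j` is the least squared integer distance from `T j` to another row (a
decidable certificate for the nearest-neighbour distances of `cfg c T`). -/
def IsMinSq (T : Fin N → Fin 3 → ℤ) (m : Fin N → ℤ) : Prop :=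
  (∀ j, ∃ k, k ≠ j ∧ sqNormInt (T j - T k) = m j) ∧ ∀ j k, k ≠ j → m j ≤ sqNormInt (T j - T k)

/-- `IsMinSq` is decidable (finite quantifiers over `Fin N`, integer arithmetic). -/
instance (T : Fin N → Fin 3 → ℤ) (m : Fin N → ℤ) : Decidable (IsMinSq T m) := by
  unfold IsMinSq; infer_instance

/-- With a min-square certificate, `nn_j = |c|·√(m j)`. -/
theorem nearestDist_cfg {c : ℝ} {T : Fin N → Fin 3 → ℤ} {m : Fin N → ℤ} (hm : IsMinSq T m)
    (j : Fin N) : nearestDist (cfg c T) j = |c| * Real.sqrt (m j) := by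
  apply le_antisymm
  · obtain ⟨k, hk, hkm⟩ := hm.1 j
    calc nearestDist (cfg c T) j ≤ dist (cfg c T j) (cfg c T k) := nearestDist_le_dist _ hk
      _ = |c| * Real.sqrt (m j) := by rw [dist_cfg, hkm]
  · obtain ⟨k, hk, -⟩ := hm.1 j
    refine le_nearestDist ⟨k, hk⟩ fun k hk => ?_
    rw [dist_cfg]
    have hle : ((m j : ℤ) : ℝ) ≤ (sqNormInt (T j - T k) : ℝ) := by exact_mod_cast hm.2 j k hk
    exact mul_le_mul_of_nonneg_left (Real.sqrt_le_sqrt hle) (abs_nonneg c)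

/-- The integer form of adjacency in `bondGraph (1/100) (cfg c T)`:
`10000·|T j − T k|² ≤ 10201·min(m j, m k)`. -/
def AdjInt (T : Fin N → Fin 3 → ℤ) (m : Fin N → ℤ) (j k : Fin N) : Prop :=
  j ≠ k ∧ 10000 * sqNormInt (T j - T k) ≤ 10201 * min (m j) (m k)

/-- `AdjInt` is decidable. -/
instance (T : Fin N → Fin 3 → ℤ) (m : Fin N → ℤ) : DecidableRel (AdjInt T m) := by
  unfold AdjInt; infer_instance

/-- **Bridge.** For `c ≠ 0` and a min-square certificate, the scale-free bond graph at tolerance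
`1/100` of `cfg c T` is the decidable integer relation `AdjInt T m`. -/
theorem bondGraph_cfg_adj {c : ℝ} (hc : c ≠ 0) {T : Fin N → Fin 3 → ℤ} {m : Fin N → ℤ}
    (hm : IsMinSq T m) (j k : Fin N) :
    (bondGraph (1 / 100) (cfg c T)).Adj j k ↔ AdjInt T m j k := by
  rw [bondGraph_adj, dist_cfg, nearestDist_cfg hm, nearestDist_cfg hm]
  unfold AdjInt
  refine and_congr_right fun hjk => ?_
  have hc' : 0 < |c| := abs_pos.2 hc
  have hm0 : ∀ l, (0 : ℝ) ≤ (m l : ℝ) := fun l => by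
    obtain ⟨k', hk', hk'm⟩ := hm.1 l
    have := sqNormInt_nonneg (T l - T k')
    rw [hk'm] at this
    exact_mod_cast this
  set d : ℝ := (sqNormInt (T j - T k) : ℝ) with hd
  set M : ℝ := ((min (m j) (m k) : ℤ) : ℝ) with hM
  have hmono : Monotone Real.sqrt := fun x y hxy => Real.sqrt_le_sqrt hxy
  have hMmin : min (Real.sqrt (m j)) (Real.sqrt (m k)) = Real.sqrt M := by
    rw [hM, Int.cast_min, hmono.map_min]
  have hM0 : 0 ≤ M := by rw [hM, Int.cast_min]; exact le_min (hm0 j) (hm0 k)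
  have hd0 : 0 ≤ d := by rw [hd]; exact_mod_cast sqNormInt_nonneg _
  rw [← mul_min_of_nonneg _ _ hc'.le, hMmin, mul_left_comm, mul_le_mul_iff_right₀ hc']
  have key : Real.sqrt d ≤ (1 + 1 / 100) * Real.sqrt M ↔ 10000 * d ≤ 10201 * M := by
    rw [show (1 + 1 / 100 : ℝ) * Real.sqrt M = Real.sqrt ((101 / 100) ^ 2 * M) by
      rw [Real.sqrt_mul (by positivity), Real.sqrt_sq (by norm_num)]; norm_num]
    rw [Real.sqrt_le_sqrt_iff (by positivity)]
    constructor <;> intro h' <;> nlinarith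
  rw [key, hd, hM]
  constructor
  · intro h'; exact_mod_cast h'
  · intro h'; exact_mod_cast h'

/-- Neighbour sets of `cfg c T` as filtered finsets of the integer relation. -/
theorem neighborSet_cfg {c : ℝ} (hc : c ≠ 0) {T : Fin N → Fin 3 → ℤ} {m : Fin N → ℤ}
    (hm : IsMinSq T m) (i : Fin N) :
    (bondGraph (1 / 100) (cfg c T)).neighborSet i = ↑(Finset.univ.filter (AdjInt T m i)) := by
  ext k
  rw [SimpleGraph.mem_neighborSet, bondGraph_cfg_adj hc hm, Finset.coe_filter]
  simp

/-- Integer-side charge-freeness: `12` integer-adjacent rows, each sharing exactly `4`. -/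
def ChargeFreeInt (T : Fin N → Fin 3 → ℤ) (m : Fin N → ℤ) (i : Fin N) : Prop :=
  (Finset.univ.filter (AdjInt T m i)).card = 12 ∧
    ∀ j, AdjInt T m i j → (Finset.univ.filter fun k => AdjInt T m i k ∧ AdjInt T m j k).card = 4

/-- `ChargeFreeInt` is decidable. -/
instance (T : Fin N → Fin 3 → ℤ) (m : Fin N → ℤ) (i : Fin N) : Decidable (ChargeFreeInt T m i) := by
  unfold ChargeFreeInt; infer_instance

/-- **`IsChargeFree (1/100)` of an integer-coordinate configuration is decidable**: it is
`ChargeFreeInt T m i` for any min-square certificate `m`. -/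
theorem isChargeFree_cfg_iff {c : ℝ} (hc : c ≠ 0) {T : Fin N → Fin 3 → ℤ} {m : Fin N → ℤ}
    (hm : IsMinSq T m) (i : Fin N) :
    IsChargeFree (1 / 100) (cfg c T) i ↔ ChargeFreeInt T m i := by
  rw [isChargeFree_iff, neighborSet_cfg hc hm, Set.ncard_coe_finset]
  unfold ChargeFreeInt
  refine and_congr_right fun _ => ?_
  refine ⟨fun H j hj => ?_, fun H j hj => ?_⟩
  · have hj' : j ∈ (↑(Finset.univ.filter (AdjInt T m i)) : Set (Fin N)) := by simpa using hj
    have := H j hj'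
    rwa [ringNumber_def, neighborSet_cfg hc hm, neighborSet_cfg hc hm, ← Finset.coe_inter,
      Set.ncard_coe_finset, ← Finset.filter_and] at this
  · have hj' : AdjInt T m i j := by simpa using hj
    rw [ringNumber_def, neighborSet_cfg hc hm, neighborSet_cfg hc hm, ← Finset.coe_inter,
      Set.ncard_coe_finset, ← Finset.filter_and]
    exact H j hj'

/-- Distinct rows give distinct sites. -/
theorem cfg_injective {c : ℝ} (hc : c ≠ 0) {T : Fin N → Fin 3 → ℤ} (hT : Function.Injective T) :
    Function.Injective (cfg c T) := fun _ _ h =>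
  hT (intVec_injective (smul_right_injective E3 hc h))

end IntCert

/-! ## §3 Load-bearing hypotheses: the charge-free BALL is used beyond the first shell -/

section LoadBearing

/-- The crux with the hypothesis ball shrunk to the centre alone (`ρ = 0`: only `y i` itself is
required to be charge-free). -/
def SoftLayerPropagationWithoutBall : Prop := SLP 0 3 (1 / 6)

/-- The crux with hypothesis radius `3/2` instead of `8` (the centre, its bonded shell and the six
octahedral second neighbours at `√2·nn` charge-free). -/
def SoftLayerPropagationRadiusThreeHalves : Prop := SLP (3 / 2) 3 (1 / 6)

/-- `SLP` is monotone in the hypothesis radius: a larger charge-free ball is a stronger hypothesis. -/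
theorem SLP.mono {ρ ρ' R τ : ℝ} (hρ : ρ ≤ ρ') (H : SLP ρ R τ) : SLP ρ' R τ := by
  intro η hη hη1 N y i hball
  exact H η hη hη1 N y i fun j hj =>
    hball j (hj.trans (mul_le_mul_of_nonneg_right hρ (nearestDist_nonneg y i)))

/-- The 13-point cuboctahedral cluster: centre and the twelve fcc neighbours `(±1, ±1, 0)` etc.
(integer coordinates, nearest-neighbour distance `√2`). -/
def T13 : Fin 13 → Fin 3 → ℤ := ![![0, 0, 0], ![1, 1, 0], ![1, 0, 1], ![1, 0, -1], ![1, -1, 0], ![0, 1, 1], ![0, 1, -1], ![0, -1, 1], ![0, -1, -1], ![-1, 1, 0], ![-1, 0, 1], ![-1, 0, -1], ![-1, -1, 0]]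

/-- The 79-point fcc cluster: the `19` fcc points of squared norm `≤ 4` (centre, the twelve at `√2`,
the six at `2`) together with all their fcc neighbours (squared norms `≤ 10`). -/
def T79 : Fin 79 → Fin 3 → ℤ := ![![0, 0, 0], ![1, 1, 0], ![1, 0, 1], ![1, 0, -1], ![1, -1, 0], ![0, 1, 1], ![0, 1, -1], ![0, -1, 1], ![0, -1, -1], ![-1, 1, 0], ![-1, 0, 1], ![-1, 0, -1], ![-1, -1, 0], ![2, 0, 0], ![0, 2, 0], ![0, 0, 2], ![0, 0, -2], ![0, -2, 0], ![-2, 0, 0], ![2, 1, 1], ![2, 1, -1], ![2, -1, 1], ![2, -1, -1], ![1, 2, 1], ![1, 2, -1], ![1, 1, 2], ![1, 1, -2], ![1, -1, 2], ![1, -1, -2], ![1, -2, 1], ![1, -2, -1], ![-1, 2, 1], ![-1, 2, -1], ![-1, 1, 2], ![-1, 1, -2], ![-1, -1, 2], ![-1, -1, -2], ![-1, -2, 1], ![-1, -2, -1], ![-2, 1, 1], ![-2, 1, -1], ![-2, -1, 1], ![-2, -1, -1], ![2, 2, 0], ![2, 0, 2], ![2, 0, -2], ![2, -2, 0], ![0,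 2, 2], ![0, 2, -2], ![0, -2, 2], ![0, -2, -2], ![-2, 2, 0], ![-2, 0, 2], ![-2, 0, -2], ![-2, -2, 0], ![3, 1, 0], ![3, 0, 1], ![3, 0, -1], ![3, -1, 0], ![1, 3, 0], ![1, 0, 3], ![1, 0, -3], ![1, -3, 0], ![0, 3, 1], ![0, 3, -1], ![0, 1, 3], ![0, 1, -3], ![0, -1, 3], ![0, -1, -3], ![0, -3, 1], ![0, -3, -1], ![-1, 3, 0], ![-1, 0, 3], ![-1, 0, -3], ![-1, -3, 0], ![-3, 1, 0], ![-3, 0, 1], ![-3, 0, -1], ![-3, -1, 0]]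

/-- Certificate for `T13`: nearest squared distance `2` everywhere, the centre is integer-charge-free,
rows distinct (`decide`). -/
theorem T13_cert : IsMinSq T13 (fun _ => 2) ∧ ChargeFreeInt T13 (fun _ => 2) 0 ∧ Function.Injective T13 := by
  refine ⟨by decide, by decide, by decide⟩

set_option maxRecDepth 100000 in
/-- Certificate for `T79`: nearest squared distance `2` everywhere, the `19` inner rows are
integer-charge-free, rows distinct (`decide +kernel`). -/
theorem T79_cert : IsMinSq T79 (fun _ => 2) ∧
    (∀ j : Fin 79, sqNormInt (T79 0 - T79 j) ≤ 4 → ChargeFreeInt T79 (fun _ => 2) j) ∧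
    Function.Injective T79 := by
  refine ⟨by decide +kernel, by decide +kernel, by decide +kernel⟩

/-- From the conclusion of `SLP ρ 3 (1/6)` at a centre with positive scale, `85 ≤ N`. -/
theorem le_card_of_SLP_conclusion {N : ℕ} {y : Fin N → E3} {i : Fin N}
    (ha : 0 < nearestDist y i) {s : ℤ → ℤ} (hs : IsHaggSeq s) (g : E3 ≃ᵃⁱ[ℝ] E3)
    (hcl1 : ∀ j : Fin N, dist (y i) (y j) ≤ 3 * nearestDist y i →
        ∃ z ∈ barlowStacking (nearestDist y i) (nearestDist y i * Real.sqrt (2 / 3)) s,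
          dist (y j) (g z) ≤ 1 / 6 * nearestDist y i)
    (hcl2 : ∀ z ∈ barlowStacking (nearestDist y i) (nearestDist y i * Real.sqrt (2 / 3)) s,
        dist (y i) (g z) ≤ 3 * nearestDist y i → ∃ j : Fin N, dist (y j) (g z) ≤ 1 / 6 * nearestDist y i) :
    85 ≤ N := by
  refine le_card_of_barlowMatched y i ha hs g ?_ ?_
  · obtain ⟨z, hz, hd⟩ := hcl1 i (by rw [dist_self]; positivity)
    exact ⟨z, hz, by linarith⟩
  · intro z hz hzd
    obtain ⟨j, hj⟩ := hcl2 z hz hzd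
    exact ⟨j, by linarith⟩

/-- **Load-bearing (ball hypothesis).** `¬ SLP 0 3 (1/6)`: a charge-free CENTRE alone does not give
the conclusion.  Witness: the 13-point cuboctahedral cluster `T13` at `η = 1/100` — its centre is
charge-free (12 bonds of length `√2`, every bond with exactly `4` common neighbours, by `decide`),
but a both-ways `a/6`-matching of the `3a`-ball needs `≥ 85` sites (`le_card_of_barlowMatched`). -/
theorem softLayerPropagation_false_without_ball : ¬ SoftLayerPropagationWithoutBall := by
  intro H
  obtain ⟨hmin, hcf, hinj⟩ := T13_cert
  have hyinj := cfg_injective one_ne_zero hinj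
  have hnn : nearestDist (cfg 1 T13) 0 = Real.sqrt 2 := by
    rw [nearestDist_cfg (c := 1) hmin]; simp
  have ha : 0 < nearestDist (cfg 1 T13) 0 := by rw [hnn]; positivity
  obtain ⟨s, g, hs, hcl1, hcl2⟩ := H (1 / 100) (by norm_num) le_rfl 13 (cfg 1 T13) 0 (by
    intro j hj
    rw [zero_mul] at hj
    obtain rfl : 0 = j := hyinj (dist_le_zero.1 hj)
    exact (isChargeFree_cfg_iff one_ne_zero hmin 0).2 hcf)
  have := le_card_of_SLP_conclusion ha hs g hcl1 hcl2
  omega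

/-- **Load-bearing (radius).** `¬ SLP (3/2) 3 (1/6)`: charge-freeness of the centre, of its
twelve neighbours and of its six second neighbours is still not enough.  Witness: the 79-point fcc
cluster `T79` at `η = 1/100`: its `19` inner sites (squared integer norm `≤ 4`, i.e. within
`(3/2)·nn` of the centre since `4 ≤ 2·(3/2)² < 6`) are charge-free by `decide`, and `79 < 85`.  With
`SLP.mono` this contains `¬ SLP ρ 3 (1/6)` for every `ρ ≤ 3/2`; the counting method stops here (the
radius-`2` cluster has `147 > 141 =` number of fcc points within `(3 - 1/6)·a`). -/
theorem softLayerPropagation_false_radius_threeHalves : ¬ SoftLayerPropagationRadiusThreeHalves := by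
  intro H
  obtain ⟨hmin, hcf, hinj⟩ := T79_cert
  have hyinj := cfg_injective one_ne_zero hinj
  have hnn : nearestDist (cfg 1 T79) 0 = Real.sqrt 2 := by
    rw [nearestDist_cfg (c := 1) hmin]; simp
  have ha : 0 < nearestDist (cfg 1 T79) 0 := by rw [hnn]; positivity
  obtain ⟨s, g, hs, hcl1, hcl2⟩ := H (1 / 100) (by norm_num) le_rfl 79 (cfg 1 T79) 0 (by
    intro j hj
    rw [hnn, dist_cfg, abs_one, one_mul, show (3 / 2 : ℝ) * Real.sqrt 2 = Real.sqrt (9 / 2) by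
        rw [show (9 / 2 : ℝ) = (3 / 2) ^ 2 * 2 by norm_num, Real.sqrt_mul (by norm_num),
          Real.sqrt_sq (by norm_num)],
      Real.sqrt_le_sqrt_iff (by norm_num)] at hj
    have hj' : (sqNormInt (T79 0 - T79 j) : ℝ) < 5 := by linarith
    have hj'' : sqNormInt (T79 0 - T79 j) ≤ 4 := by
      have : sqNormInt (T79 0 - T79 j) < 5 := by exact_mod_cast hj'
      omega
    exact (isChargeFree_cfg_iff one_ne_zero hmin j).2 (hcf j hj''))
  have := le_card_of_SLP_conclusion ha hs g hcl1 hcl2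
  omega

/-- Corollary: hypothesis radius `1`. -/
theorem softLayerPropagation_false_radius_one : ¬ SLP 1 3 (1 / 6) := fun H =>
  softLayerPropagation_false_radius_threeHalves (H.mono (by norm_num))

end LoadBearing

/-! ## §4 (emptied — the near-misses of earlier versions are the theorems of §5 and §6) -/

/-! ## §5 Tightness of the tolerance: `¬ SLP 8 3 (1/20)` (uniform 2 % cube-axis strain) -/

section Tightness

variable {N : ℕ}

/-! ### Tuple-side integer certificates (fast under `native_decide`) -/

/-- Integer triples. -/
abbrev P3 := ℤ × ℤ × ℤ

/-- Triple to coordinate vector. -/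
def toVec (p : P3) : Fin 3 → ℤ := ![p.1, p.2.1, p.2.2]

/-- Squared distance of triples. -/
def sqN3 (p q : P3) : ℤ := (p.1 - q.1) ^ 2 + (p.2.1 - q.2.1) ^ 2 + (p.2.2 - q.2.2) ^ 2

/-- `sqNormInt (toVec p − toVec q) = sqN3 p q`. -/
theorem sqNormInt_toVec_sub (p q : P3) : sqNormInt (toVec p - toVec q) = sqN3 p q := by
  simp [sqNormInt, toVec, sqN3]

/-- Tuple form of `AdjInt`. -/
def AdjInt3 (T : Fin N → P3) (m : Fin N → ℤ) (j k : Fin N) : Prop :=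
  j ≠ k ∧ 10000 * sqN3 (T j) (T k) ≤ 10201 * min (m j) (m k)

/-- `AdjInt3` is decidable. -/
instance (T : Fin N → P3) (m : Fin N → ℤ) : DecidableRel (AdjInt3 T m) := by
  unfold AdjInt3; infer_instance

/-- `AdjInt (toVec ∘ T) = AdjInt3 T`. -/
theorem adjInt_toVec_iff (T : Fin N → P3) (m : Fin N → ℤ) (j k : Fin N) :
    AdjInt (toVec ∘ T) m j k ↔ AdjInt3 T m j k := by
  simp only [AdjInt, AdjInt3, Function.comp_apply, sqNormInt_toVec_sub]

/-- Bool certificate of charge-freeness (the neighbour list is computed once). -/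
def cfB (T : Fin N → P3) (m : Fin N → ℤ) (i : Fin N) : Bool :=
  let S := (List.finRange N).filter fun k => decide (AdjInt3 T m i k)
  (S.length == 12) && S.all fun j => (S.filter fun k => decide (AdjInt3 T m j k)).length == 4

/-- Bool certificate of a min-square table. -/
def minSqB (T : Fin N → P3) (m : Fin N → ℤ) : Bool :=
  (List.finRange N).all fun j =>
    ((List.finRange N).any fun k => decide (k ≠ j) && (sqN3 (T j) (T k) == m j)) &&
      (List.finRange N).all fun k => decide (k = j) || decide (m j ≤ sqN3 (T j) (T k))

/-- Cardinal of a filtered `univ : Finset (Fin N)` as a list length. -/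
theorem card_univ_filter_eq_length (p : Fin N → Prop) [DecidablePred p] :
    (Finset.univ.filter p).card = ((List.finRange N).filter fun k => decide (p k)).length := by
  rw [Fin.univ_def]
  rfl

/-- The Bool certificate implies `ChargeFreeInt`. -/
theorem chargeFreeInt_of_cfB {T : Fin N → P3} {m : Fin N → ℤ} {i : Fin N} (h : cfB T m i = true) :
    ChargeFreeInt (toVec ∘ T) m i := by
  unfold cfB at h
  simp only [Bool.and_eq_true, beq_iff_eq, List.all_eq_true] at h
  obtain ⟨h12, h4⟩ := h
  have hfilt : ∀ (p q : Fin N → Prop) [DecidablePred p] [DecidablePred q], (∀ k, p k ↔ q k) →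
      Finset.univ.filter p = Finset.univ.filter q := fun p q _ _ hpq =>
    Finset.filter_congr fun k _ => hpq k
  constructor
  · rw [hfilt _ _ (adjInt_toVec_iff T m i), card_univ_filter_eq_length]
    exact h12
  · intro j hj
    rw [adjInt_toVec_iff] at hj
    have hjS : j ∈ (List.finRange N).filter fun k => decide (AdjInt3 T m i k) := by
      simp [List.mem_filter, hj]
    have := h4 j hjS
    rw [hfilt _ _ (fun k => and_congr (adjInt_toVec_iff T m i k) (adjInt_toVec_iff T m j k)),
      ← Finset.filter_filter, Finset.filter_filter, card_univ_filter_eq_length]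
    rw [List.filter_filter] at this
    rw [show (fun k => decide (AdjInt3 T m i k ∧ AdjInt3 T m j k)) =
        (fun a => decide (AdjInt3 T m j a) && decide (AdjInt3 T m i a)) from
      funext fun k => by rw [Bool.decide_and, Bool.and_comm]]
    exact this

/-- The Bool certificate implies `IsMinSq`. -/
theorem isMinSq_of_minSqB {T : Fin N → P3} {m : Fin N → ℤ} (h : minSqB T m = true) :
    IsMinSq (toVec ∘ T) m := by
  unfold minSqB at h
  simp only [List.all_eq_true, Bool.and_eq_true, List.any_eq_true, Bool.or_eq_true,
    decide_eq_true_eq, beq_iff_eq, List.mem_finRange, true_and, forall_const] at h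
  constructor
  · intro j
    obtain ⟨⟨k, hk, hkm⟩, -⟩ := h j
    exact ⟨k, hk, by rw [Function.comp_apply, Function.comp_apply, sqNormInt_toVec_sub]; exact hkm⟩
  · intro j k hkj
    obtain ⟨-, hall⟩ := h j
    rcases hall k with hk | hk
    · exact absurd hk hkj
    · rw [Function.comp_apply, Function.comp_apply, sqNormInt_toVec_sub]; exact hk

/-! ### The Barlow distance gap: no Barlow distance strictly between `a` and `√2·a`, nor between
`√2·a` and `√(8/3)·a` -/

/-- **Barlow distance trichotomy.**  Two points of an ideal Barlow stacking (`h = a√(2/3)`) are at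
squared distance `≤ a²`, or exactly `2a²` (octahedral second neighbours), or `≥ 8a²/3`: within a
layer and between adjacent layers the squared distance is an INTEGER multiple of `a²`
(`dist_sq_sameLayer`, `dist_sq_succLayer`), and layers two apart are `≥ 2h = √(8/3)·a` apart. -/
theorem barlow_dist_sq_trichotomy {a : ℝ} (ha : 0 < a) {s : ℤ → ℤ} (hs : IsHaggSeq s) {z z' : E3}
    (hz : z ∈ barlowStacking a (a * Real.sqrt (2 / 3)) s)
    (hz' : z' ∈ barlowStacking a (a * Real.sqrt (2 / 3)) s) :
    dist z z' ^ 2 ≤ a ^ 2 ∨ dist z z' ^ 2 = 2 * a ^ 2 ∨ 8 * a ^ 2 / 3 ≤ dist z z' ^ 2 := by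
  set h := a * Real.sqrt (2 / 3) with hh_def
  have hsq23 : Real.sqrt (2 / 3) ^ 2 = 2 / 3 := Real.sq_sqrt (by norm_num)
  have hh2 : h ^ 2 = 2 * a ^ 2 / 3 := by rw [hh_def, mul_pow, hsq23]; ring
  have hhpos : 0 < h := by positivity
  obtain ⟨k, i, j, rfl⟩ := hz
  obtain ⟨k', i', j', rfl⟩ := hz'
  -- integer multiples of a²
  have hint : ∀ (E : ℤ) (d : ℝ), d ^ 2 = a ^ 2 * E →
      d ^ 2 ≤ a ^ 2 ∨ d ^ 2 = 2 * a ^ 2 ∨ 8 * a ^ 2 / 3 ≤ d ^ 2 := by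
    intro E d hE
    have ha2 : 0 ≤ a ^ 2 := sq_nonneg a
    rcases (show E ≤ 1 ∨ E = 2 ∨ 3 ≤ E by omega) with h1 | h2 | h3
    · left; rw [hE]; have : (E : ℝ) ≤ 1 := (by exact_mod_cast h1); nlinarith
    · right; left; rw [hE, h2]; push_cast; ring
    · right; right; rw [hE]; have : (3 : ℝ) ≤ E := (by exact_mod_cast h3); nlinarith
  wlog hkk : k' ≤ k generalizing k i j k' i' j'
  · have := this k' i' j' k i j (le_of_not_ge hkk)
    rwa [dist_comm] at this
  rcases hkk.lt_or_eq with hlt | heq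
  · rcases (show k = k' + 1 ∨ k' + 2 ≤ k by omega) with h1 | h2
    · subst h1
      refine hint (((i - i') ^ 2 + (i - i') * (j - j') + (j - j') ^ 2 +
        s k' * ((i - i') + (j - j'))) + 1) _ ?_
      rw [dist_sq_succLayer a h hs, hh2]; push_cast; ring
    · right; right
      have h3 := PiLp.dist_apply_le (barlowPos a h s k i j) (barlowPos a h s k' i' j') 2
      rw [barlowPos_apply_two, barlowPos_apply_two, Real.dist_eq, ← sub_mul, abs_mul,
        abs_of_pos hhpos] at h3
      have hk2 : (2 : ℝ) ≤ |(k : ℝ) - k'| := by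
        rw [← Int.cast_sub, ← Int.cast_abs]
        exact_mod_cast (show (2 : ℤ) ≤ |k - k'| by rw [abs_of_nonneg (by omega)]; omega)
      have h4 : 2 * h ≤ dist (barlowPos a h s k i j) (barlowPos a h s k' i' j') :=
        le_trans (by nlinarith) h3
      nlinarith [h4, hh2]
  · subst heq
    refine hint ((i - i') ^ 2 + (i - i') * (j - j') + (j - j') ^ 2) _ ?_
    rw [dist_sq_sameLayer]

/-- In particular a Barlow distance strictly between `a` and `√(8/3)·a` equals `√2·a`. -/
theorem barlow_dist_eq_sqrt_two {a : ℝ} (ha : 0 < a) {s : ℤ → ℤ} (hs : IsHaggSeq s) {z z' : E3}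
    (hz : z ∈ barlowStacking a (a * Real.sqrt (2 / 3)) s)
    (hz' : z' ∈ barlowStacking a (a * Real.sqrt (2 / 3)) s)
    (h1 : a ^ 2 < dist z z' ^ 2) (h2 : dist z z' ^ 2 < 8 * a ^ 2 / 3) :
    dist z z' = Real.sqrt 2 * a := by
  rcases barlow_dist_sq_trichotomy ha hs hz hz' with h | h | h
  · linarith
  · rw [← Real.sqrt_sq dist_nonneg, h, Real.sqrt_mul' _ (sq_nonneg a), Real.sqrt_sq ha.le]
  · linarith

/-! ### The strained ball -/

/-- The fcc points `(x, y, z)`, `x + y + z` even, `x² + y² + z² ≤ R2`, `|x|,|y|,|z| ≤ B`, stretched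
by `1.0199` along the cube axis `z`, in units of `1/10000`: `(10000x, 10000y, 10199z)`. -/
def genBall3 (B : ℕ) (R2 : ℤ) : List P3 :=
  (List.range (2 * B + 1)).flatMap fun i => (List.range (2 * B + 1)).flatMap fun j =>
    (List.range (2 * B + 1)).filterMap fun k =>
      let x : ℤ := (i : ℤ) - B
      let y : ℤ := (j : ℤ) - B
      let z : ℤ := (k : ℤ) - B
      if (x + y + z) % 2 = 0 ∧ x ^ 2 + y ^ 2 + z ^ 2 ≤ R2 then
        some (10000 * x, 10000 * y, 10199 * z) else none

/-- The `5979` strained fcc points with `x² + y² + z² ≤ 200`, as an array. -/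
def ballArr : Array P3 := (genBall3 15 200).toArray

/-- The strained-ball table (index `2989` is the centre; `2987 … 2991` is the chain
`(0, 0, 20398·m)`, `m = −2 … 2`). -/
@[irreducible] def Tst : Fin 5979 → P3 := fun j => ballArr.getD j.val (0, 0, 0)

/-- COMPUTATIONAL CERTIFICATE (`native_decide`, ≈ 160 s on the farm; axiom `Lean.ofReduceBool`):
the chain rows, the min-square table (`2·10⁸` everywhere: every row has an in-plane neighbour),
and charge-freeness (Bool form) of every row within `8·nn` of the centre
(`sqN3 ≤ 64·2·10⁸`) — `2999` rows. -/
theorem Tst_cert :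
    Tst 2987 = (0, 0, -40796) ∧ Tst 2988 = (0, 0, -20398) ∧ Tst 2989 = (0, 0, 0) ∧
    Tst 2990 = (0, 0, 20398) ∧ Tst 2991 = (0, 0, 40796) ∧
    minSqB Tst (fun _ => 200000000) = true ∧
    ((List.finRange 5979).all fun j =>
      !(decide (sqN3 (Tst 2989) (Tst j) ≤ 12800000000)) || cfB Tst (fun _ => 200000000) j) = true := by
  native_decide

/-- **Tightness of the matching tolerance.** `¬ SLP 8 3 (1/20)`: at `η = 1/100` the conclusion of
the crux fails with tolerance `nn/20` in place of `nn/6`.  Witness: fcc stretched by `q = 1.0199`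
along a cube axis — bond spread `√((1 + q²)/2) − 1 < 1 %`, so every one of the `2999` sites within
`8·nn` of the centre of the `5979`-site ball `Tst` is charge-free (`Tst_cert`), `nn` = in-plane bond
`= 10⁴√2`.  The five collinear sites `(0, 0, 20398·m)`, `m = −2 … 2` (all within `3·nn`), are matched
to Barlow points `z_m`; consecutive ones are then at a distance in `20398 ± nn/10 ⊆ (nn, √(8/3)·nn)`,
hence at distance EXACTLY `√2·nn` (`barlow_dist_eq_sqrt_two`), so `dist z₋₂ z₂ ≤ 4√2·nn ≈ 80003`,
whereas the matching forces `dist z₋₂ z₂ ≥ 81592 − nn/10 ≈ 80178`.  Threshold of this witness: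
`τ⋆ = 2√2(q − 1) ≈ 0.0563`; so the octet-truss rigidity constant `C` of "deviation ≤ C·η·R·nn"
obeys `C ≥ 1.9`, while the crux needs `C < 5.6`. -/
theorem softLayerPropagation_tolerance_lb : ¬ SLP 8 3 (1 / 20) := by
  intro H
  obtain ⟨h87, h88, h89, h90, h91, hminB, hcfB⟩ := Tst_cert
  have hmin : IsMinSq (toVec ∘ Tst) (fun _ => 200000000) := isMinSq_of_minSqB hminB
  clear hminB
  have hcf : ∀ j : Fin 5979, sqN3 (Tst 2989) (Tst j) ≤ 12800000000 →
      ChargeFreeInt (toVec ∘ Tst) (fun _ => 200000000) j := by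
    intro j hj
    have hall := List.all_eq_true.1 hcfB j (List.mem_finRange j)
    rw [Bool.or_eq_true, Bool.not_eq_true', decide_eq_false_iff_not] at hall
    rcases hall with hno | hcf
    · exact absurd hj hno
    · exact chargeFreeInt_of_cfB hcf
  clear hcfB
  have hnn : nearestDist (cfg 1 (toVec ∘ Tst)) 2989 = Real.sqrt 200000000 := by
    rw [nearestDist_cfg (c := 1) hmin]; simp
  set y : Fin 5979 → E3 := cfg 1 (toVec ∘ Tst) with hy
  set a := nearestDist y 2989 with ha_def
  have ha2 : a ^ 2 = 200000000 := by rw [hnn, Real.sq_sqrt (by norm_num)]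
  have ha0 : 0 < a := by rw [hnn]; positivity
  have ha_lt : a < 14143 := by nlinarith [sq_nonneg (a - 14143)]
  have ha_gt : 14142 < a := by nlinarith [sq_nonneg (a + 14142)]
  have hdist : ∀ j k, dist (y j) (y k) = Real.sqrt (sqN3 (Tst j) (Tst k)) := by
    intro j k
    rw [hy, dist_cfg, abs_one, one_mul, Function.comp_apply, Function.comp_apply,
      sqNormInt_toVec_sub]
  -- the hypothesis of the crux holds on the 8-ball
  have hball : ∀ j, dist (y 2989) (y j) ≤ 8 * a → IsChargeFree (1 / 100) y j := by
    intro j hj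
    have hj' : sqN3 (Tst 2989) (Tst j) ≤ 12800000000 := by
      rw [hdist, hnn, show (8 : ℝ) * Real.sqrt 200000000 = Real.sqrt 12800000000 by
          rw [show (12800000000 : ℝ) = 8 ^ 2 * 200000000 by norm_num, Real.sqrt_mul (by norm_num),
            Real.sqrt_sq (by norm_num)],
        Real.sqrt_le_sqrt_iff (by norm_num)] at hj
      exact_mod_cast hj
    exact (isChargeFree_cfg_iff one_ne_zero hmin j).2 (hcf j hj')
  obtain ⟨s, g, hs, hcl1, -⟩ := H (1 / 100) (by norm_num) le_rfl 5979 y 2989 hball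
  -- the five chain sites and their matches
  have d01 : dist (y 2989) (y 2990) = 20398 := by rw [hdist, h89, h90]; norm_num [sqN3]
  have d12 : dist (y 2990) (y 2991) = 20398 := by rw [hdist, h90, h91]; norm_num [sqN3]
  have dm10 : dist (y 2988) (y 2989) = 20398 := by rw [hdist, h88, h89]; norm_num [sqN3]
  have dm2m1 : dist (y 2987) (y 2988) = 20398 := by rw [hdist, h87, h88]; norm_num [sqN3]
  have d02 : dist (y 2989) (y 2991) = 40796 := by rw [hdist, h89, h91]; norm_num [sqN3]
  have d0m2 : dist (y 2989) (y 2987) = 40796 := by rw [hdist, h89, h87]; norm_num [sqN3]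
  have d0m1 : dist (y 2989) (y 2988) = 20398 := by rw [dist_comm]; exact dm10
  have dm22 : dist (y 2987) (y 2991) = 81592 := by rw [hdist, h87, h91]; norm_num [sqN3]
  have hB := fun (idx : Fin 5979) (hidx : dist (y 2989) (y idx) ≤ 3 * a) => hcl1 idx hidx
  obtain ⟨z0, hz0, e0⟩ := hB 2989 (by rw [dist_self]; positivity)
  obtain ⟨z1, hz1, e1⟩ := hB 2990 (by rw [d01]; linarith)
  obtain ⟨z2, hz2, e2⟩ := hB 2991 (by rw [d02]; linarith)
  obtain ⟨zm1, hzm1, em1⟩ := hB 2988 (by rw [d0m1]; linarith)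
  obtain ⟨zm2, hzm2, em2⟩ := hB 2987 (by rw [d0m2]; linarith)
  -- consecutive matched points are exactly √2·a apart
  have step : ∀ (p q : Fin 5979) (zp zq : E3), dist (y p) (y q) = 20398 →
      zp ∈ barlowStacking a (a * Real.sqrt (2 / 3)) s → zq ∈ barlowStacking a (a * Real.sqrt (2 / 3)) s →
      dist (y p) (g zp) ≤ 1 / 20 * a → dist (y q) (g zq) ≤ 1 / 20 * a →
      dist zp zq = Real.sqrt 2 * a := by
    intro p q zp zq hpq hzp hzq ep eq
    have hD1 : dist zp zq ≤ 20398 + a / 10 := by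
      rw [← g.dist_map]
      calc dist (g zp) (g zq) ≤ dist (g zp) (y p) + dist (y p) (y q) + dist (y q) (g zq) :=
            dist_triangle4 _ _ _ _
        _ ≤ 1 / 20 * a + 20398 + 1 / 20 * a := by rw [dist_comm (g zp)]; linarith
        _ = 20398 + a / 10 := by ring
    have hD2 : 20398 - a / 10 ≤ dist zp zq := by
      rw [← g.dist_map]
      have := dist_triangle4 (y p) (g zp) (g zq) (y q)
      rw [dist_comm (g zq) (y q)] at this
      linarith
    have hD0 : 0 ≤ dist zp zq := dist_nonneg
    refine barlow_dist_eq_sqrt_two ha0 hs hzp hzq ?_ ?_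
    · have hlt : a < dist zp zq := by linarith
      nlinarith [hlt, ha0]
    · have hup : dist zp zq ≤ 21813 := by linarith
      have h2 := pow_le_pow_left₀ hD0 hup 2
      rw [ha2]; norm_num at h2 ⊢; linarith
  have s1 := step 2989 2990 z0 z1 d01 hz0 hz1 e0 e1
  have s2 := step 2990 2991 z1 z2 d12 hz1 hz2 e1 e2
  have s3 := step 2988 2989 zm1 z0 dm10 hzm1 hz0 em1 e0
  have s4 := step 2987 2988 zm2 zm1 dm2m1 hzm2 hzm1 em2 em1
  -- the chain of four √2·a steps cannot span 81592 − a/10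
  have hup : dist zm2 z2 ≤ 4 * (Real.sqrt 2 * a) := by
    calc dist zm2 z2 ≤ dist zm2 zm1 + dist zm1 z0 + dist z0 z2 := dist_triangle4 _ _ _ _
      _ ≤ dist zm2 zm1 + dist zm1 z0 + (dist z0 z1 + dist z1 z2) := by
          gcongr; exact dist_triangle _ _ _
      _ = 4 * (Real.sqrt 2 * a) := by rw [s1, s2, s3, s4]; ring
  have hlo : 81592 - a / 10 ≤ dist zm2 z2 := by
    rw [← g.dist_map]
    have := dist_triangle4 (y 2987) (g zm2) (g z2) (y 2991)
    rw [dist_comm (g z2) (y 2991), dm22] at this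
    linarith
  have hs2 : Real.sqrt 2 < 1.41422 := by
    rw [Real.sqrt_lt' (by norm_num)]; norm_num
  have hprod := mul_lt_mul_of_pos_right hs2 ha0
  linarith

end Tightness

/-! ## §6 The double-twin T-junction: `¬ SLP (14/5) 3 (1/6)` -/

section Twin

/-! ### Offset adjacency -/

/-- Adjacency (distance exactly `a`) between the points at offsets `d`, `e` (layer offsets in
`{-1, 0, 1}` relative to a base layer `k`), given the Hägg signs `σm = s (k-1)`, `σp = s k`. -/
def AdjOff (σm σp : ℤ) (d e : ℤ × ℤ × ℤ) : Prop :=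
  (d.1 = e.1 ∧ Qf (d.2.1 - e.2.1) (d.2.2 - e.2.2) = 1) ∨
  (d.1 = e.1 + 1 ∧ ((e.1 = -1 ∧ Qf (d.2.1 - e.2.1) (d.2.2 - e.2.2) + σm * ((d.2.1 - e.2.1) + (d.2.2 - e.2.2)) = 0) ∨
    (e.1 = 0 ∧ Qf (d.2.1 - e.2.1) (d.2.2 - e.2.2) + σp * ((d.2.1 - e.2.1) + (d.2.2 - e.2.2)) = 0))) ∨
  (e.1 = d.1 + 1 ∧ ((d.1 = -1 ∧ Qf (e.2.1 - d.2.1) (e.2.2 - d.2.2) + σm * ((e.2.1 - d.2.1) + (e.2.2 - d.2.2)) = 0) ∨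
    (d.1 = 0 ∧ Qf (e.2.1 - d.2.1) (e.2.2 - d.2.2) + σp * ((e.2.1 - d.2.1) + (e.2.2 - d.2.2)) = 0)))

instance (σm σp : ℤ) : DecidableRel (AdjOff σm σp) := by
  unfold AdjOff; infer_instance

/-- The neighbour offsets of the origin offset. -/
def nbrOff (σm σp : ℤ) : Finset (ℤ × ℤ × ℤ) :=
  (Finset.Icc (-1 : ℤ) 1 ×ˢ (Finset.Icc (-2 : ℤ) 2 ×ˢ Finset.Icc (-2 : ℤ) 2)).filter
    fun d => AdjOff σm σp d (0, 0, 0)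

/-- **Combinatorial core**: among offsets adjacent to the origin, a unit triangle `0, d₂, d₃` with two
distinct common neighbours `q, q'` forces `s (k-1) + s k = 0` (an h-layer) and `q, q'` in layers
`±1` over the same in-layer position. -/
theorem bipyramid_core (σm σp : ℤ) (hm : σm = 1 ∨ σm = -1) (hp : σp = 1 ∨ σp = -1) :
    ∀ d₂ ∈ nbrOff σm σp, ∀ d₃ ∈ nbrOff σm σp, ∀ q ∈ nbrOff σm σp, ∀ q' ∈ nbrOff σm σp,
      AdjOff σm σp d₂ d₃ → AdjOff σm σp q d₂ → AdjOff σm σp q d₃ → AdjOff σm σp q' d₂ →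
      AdjOff σm σp q' d₃ → q ≠ q' →
      q.2 = q'.2 ∧ ((q.1 = 1 ∧ q'.1 = -1) ∨ (q.1 = -1 ∧ q'.1 = 1)) ∧ σm + σp = 0 := by
  rcases hm with rfl | rfl <;> rcases hp with rfl | rfl <;> decide +kernel


/-! ### From distances to offsets -/

section Bridge

variable {a : ℝ} {s : ℤ → ℤ}

local notation "hh" => a * Real.sqrt (2 / 3)

theorem hh_sq : (hh) ^ 2 = 2 * a ^ 2 / 3 := by
  rw [mul_pow, Real.sq_sqrt (by norm_num)]; ring

theorem hh_pos (ha : 0 < a) : 0 < hh := by positivity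

/-- same layer: distance `a` iff `Q = 1` -/
theorem dist_eq_iff_sameLayer (ha : 0 < a) (K I J I' J' : ℤ) :
    dist (barlowPos a hh s K I J) (barlowPos a hh s K I' J') = a ↔ Qf (I - I') (J - J') = 1 := by
  rw [← sq_eq_sq₀ dist_nonneg ha.le, dist_sq_sameLayer]
  unfold Qf
  have ha2 : (0 : ℝ) < a ^ 2 := by positivity
  constructor
  · intro h
    have h' : a ^ 2 * (((I - I') ^ 2 + (I - I') * (J - J') + (J - J') ^ 2 : ℤ) : ℝ) = a ^ 2 * 1 := by
      linarith
    have := mul_left_cancel₀ ha2.ne' h'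
    exact_mod_cast this
  · intro h; rw [h]; push_cast; ring

/-- consecutive layers: distance `a` iff `Q + s K (Δi + Δj) = 0` -/
theorem dist_eq_iff_succLayer (ha : 0 < a) (hs : IsHaggSeq s) (K I J I' J' : ℤ) :
    dist (barlowPos a hh s (K + 1) I J) (barlowPos a hh s K I' J') = a ↔
      Qf (I - I') (J - J') + s K * ((I - I') + (J - J')) = 0 := by
  rw [← sq_eq_sq₀ dist_nonneg ha.le, dist_sq_succLayer a _ hs, hh_sq]
  unfold Qf
  have ha2 : (0 : ℝ) < a ^ 2 := by positivity
  constructor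
  · intro h
    have h' : a ^ 2 * (((I - I') ^ 2 + (I - I') * (J - J') + (J - J') ^ 2 +
        s K * ((I - I') + (J - J')) : ℤ) : ℝ) = a ^ 2 * 0 := by linarith
    have := mul_left_cancel₀ ha2.ne' h'
    exact_mod_cast this
  · intro h; rw [h]; push_cast; ring

/-- two or more layers apart: distance `> a` -/
theorem lt_dist_of_two_le_layers (ha : 0 < a) {K K' : ℤ} (hK : 2 ≤ |K - K'|) (I J I' J' : ℤ) :
    a < dist (barlowPos a hh s K I J) (barlowPos a hh s K' I' J') := by
  have h3 := PiLp.dist_apply_le (barlowPos a hh s K I J) (barlowPos a hh s K' I' J') 2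
  rw [barlowPos_apply_two, barlowPos_apply_two, Real.dist_eq, ← sub_mul, abs_mul,
    abs_of_pos (hh_pos ha)] at h3
  have hk2 : (2 : ℝ) ≤ |(K : ℝ) - K'| := by
    rw [← Int.cast_sub, ← Int.cast_abs]; exact_mod_cast hK
  have hsq : Real.sqrt (2 / 3) > 1 / 2 := by
    rw [gt_iff_lt, show (1 / 2 : ℝ) = Real.sqrt (1 / 4) by
      rw [show (1 / 4 : ℝ) = (1 / 2) ^ 2 by norm_num, Real.sqrt_sq (by norm_num)]]
    exact Real.sqrt_lt_sqrt (by norm_num) (by norm_num)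
  have h4 : 2 * (a * Real.sqrt (2 / 3)) ≤ |(K : ℝ) - K'| * (a * Real.sqrt (2 / 3)) :=
    mul_le_mul_of_nonneg_right hk2 (hh_pos ha).le
  have h5 : a < 2 * (a * Real.sqrt (2 / 3)) := by
    nlinarith [mul_pos ha (show (0 : ℝ) < 2 * Real.sqrt (2 / 3) - 1 by linarith)]
  linarith

/-- layer difference of two points at distance `a` is at most one -/
theorem abs_layer_sub_le_one (ha : 0 < a) {K I J K' I' J' : ℤ}
    (h : dist (barlowPos a hh s K I J) (barlowPos a hh s K' I' J') = a) : |K - K'| ≤ 1 := by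
  by_contra hc
  have := lt_dist_of_two_le_layers (s := s) ha (K := K) (K' := K') (by omega) I J I' J'
  linarith

/-- the point at offset `d` from the base `(k, i, j)` -/
def offPt (a : ℝ) (s : ℤ → ℤ) (k i j : ℤ) (d : ℤ × ℤ × ℤ) : E3 :=
  barlowPos a (a * Real.sqrt (2 / 3)) s (k + d.1) (i + d.2.1) (j + d.2.2)

theorem offPt_eq (k i j k' i' j' : ℤ) :
    barlowPos a hh s k' i' j' = offPt a s k i j (k' - k, i' - i, j' - j) := by
  simp [offPt]

/-- **Bridge**: distance `a` between offset points (layer offsets in `{-1,0,1}`) iff `AdjOff`. -/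
theorem dist_offPt_eq_iff (ha : 0 < a) (hs : IsHaggSeq s) (k i j : ℤ) (d e : ℤ × ℤ × ℤ)
    (hd : d.1 = -1 ∨ d.1 = 0 ∨ d.1 = 1) (he : e.1 = -1 ∨ e.1 = 0 ∨ e.1 = 1) :
    dist (offPt a s k i j d) (offPt a s k i j e) = a ↔ AdjOff (s (k - 1)) (s k) d e := by
  obtain ⟨dk, di, dj⟩ := d
  obtain ⟨ek, ei, ej⟩ := e
  simp only at hd he
  have same : ∀ (K : ℤ), dist (barlowPos a hh s K (i + di) (j + dj)) (barlowPos a hh s K (i + ei) (j + ej)) = a ↔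
      Qf (di - ei) (dj - ej) = 1 := fun K => by
    rw [dist_eq_iff_sameLayer ha]; unfold Qf; constructor <;> intro h <;> linarith [h, show
      ((i + di - (i + ei)) ^ 2 + (i + di - (i + ei)) * (j + dj - (j + ej)) + (j + dj - (j + ej)) ^ 2 : ℤ) =
      (di - ei) ^ 2 + (di - ei) * (dj - ej) + (dj - ej) ^ 2 by ring]
  have succ : ∀ (K : ℤ), dist (barlowPos a hh s (K + 1) (i + di) (j + dj)) (barlowPos a hh s K (i + ei) (j + ej)) = a ↔
      Qf (di - ei) (dj - ej) + s K * ((di - ei) + (dj - ej)) = 0 := fun K => by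
    rw [dist_eq_iff_succLayer ha hs]; unfold Qf; constructor <;> intro h <;> linarith [h, show
      ((i + di - (i + ei)) ^ 2 + (i + di - (i + ei)) * (j + dj - (j + ej)) + (j + dj - (j + ej)) ^ 2 +
        s K * ((i + di - (i + ei)) + (j + dj - (j + ej))) : ℤ) =
      (di - ei) ^ 2 + (di - ei) * (dj - ej) + (dj - ej) ^ 2 + s K * ((di - ei) + (dj - ej)) by ring]
  have succ' : ∀ (K : ℤ), dist (barlowPos a hh s K (i + di) (j + dj)) (barlowPos a hh s (K + 1) (i + ei) (j + ej)) = a ↔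
      Qf (ei - di) (ej - dj) + s K * ((ei - di) + (ej - dj)) = 0 := fun K => by
    rw [dist_comm, dist_eq_iff_succLayer ha hs]; unfold Qf; constructor <;> intro h <;> linarith [h, show
      ((i + ei - (i + di)) ^ 2 + (i + ei - (i + di)) * (j + ej - (j + dj)) + (j + ej - (j + dj)) ^ 2 +
        s K * ((i + ei - (i + di)) + (j + ej - (j + dj))) : ℤ) =
      (ei - di) ^ 2 + (ei - di) * (ej - dj) + (ej - dj) ^ 2 + s K * ((ei - di) + (ej - dj)) by ring]
  have far : ∀ (K K' : ℤ), 2 ≤ |K - K'| →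
      (dist (barlowPos a hh s K (i + di) (j + dj)) (barlowPos a hh s K' (i + ei) (j + ej)) = a ↔ False) :=
    fun K K' hK => ⟨fun h => absurd h (ne_of_gt (lt_dist_of_two_le_layers ha hK _ _ _ _)), False.elim⟩
  unfold offPt AdjOff
  simp only
  rcases hd with rfl | rfl | rfl <;> rcases he with rfl | rfl | rfl
  · rw [same]; simp
  · rw [show k + (0 : ℤ) = (k + -1) + 1 by ring, succ', show k + -1 = k - 1 by ring]; simp
  · rw [far _ _ (by rw [show k + -1 - (k + 1) = -2 by ring]; norm_num)]; simp
  · rw [show k + (0 : ℤ) = (k + -1) + 1 by ring, succ, show k + -1 = k - 1 by ring]; simp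
  · rw [same]; simp
  · rw [show k + (1 : ℤ) = (k + 0) + 1 by ring, succ', add_zero]; simp
  · rw [far _ _ (by rw [show k + 1 - (k + -1) = 2 by ring]; norm_num)]; simp
  · rw [show k + (1 : ℤ) = (k + 0) + 1 by ring, succ, add_zero]; simp
  · rw [same]; simp

end Bridge

/-! ### The bipyramid theorem -/

section Bipyramid

variable {a : ℝ} {s : ℤ → ℤ}

local notation "hh" => a * Real.sqrt (2 / 3)

theorem Qf_eq_one_bounds {x y : ℤ} (h : Qf x y = 1) : -2 ≤ x ∧ x ≤ 2 ∧ -2 ≤ y ∧ y ≤ 2 := by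
  unfold Qf at h
  refine ⟨?_, ?_, ?_, ?_⟩
  · nlinarith [sq_nonneg (x + 2 * y)]
  · nlinarith [sq_nonneg (x + 2 * y)]
  · nlinarith [sq_nonneg (2 * x + y)]
  · nlinarith [sq_nonneg (2 * x + y)]

theorem Qf_lin_bounds {σ x y : ℤ} (hσ : σ = 1 ∨ σ = -1) (h : Qf x y + σ * (x + y) = 0) :
    -2 ≤ x ∧ x ≤ 2 ∧ -2 ≤ y ∧ y ≤ 2 := by
  unfold Qf at h
  rcases hσ with rfl | rfl
  · have : x ^ 2 + y ^ 2 ≤ 1 := by nlinarith [sq_nonneg (x + y + 1)]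
    refine ⟨?_, ?_, ?_, ?_⟩ <;> nlinarith [sq_nonneg x, sq_nonneg y]
  · have : x ^ 2 + y ^ 2 ≤ 1 := by nlinarith [sq_nonneg (x + y - 1)]
    refine ⟨?_, ?_, ?_, ?_⟩ <;> nlinarith [sq_nonneg x, sq_nonneg y]

/-- An offset adjacent to the origin (layer offset in `{-1,0,1}`) lies in `nbrOff`. -/
theorem mem_nbrOff_of_adjOff {σm σp : ℤ} (hm : σm = 1 ∨ σm = -1) (hp : σp = 1 ∨ σp = -1)
    {d : ℤ × ℤ × ℤ} (hd1 : d.1 = -1 ∨ d.1 = 0 ∨ d.1 = 1) (h : AdjOff σm σp d (0, 0, 0)) :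
    d ∈ nbrOff σm σp := by
  obtain ⟨dk, di, dj⟩ := d
  simp only at hd1
  unfold nbrOff
  rw [Finset.mem_filter]
  refine ⟨?_, h⟩
  have hb : -2 ≤ di ∧ di ≤ 2 ∧ -2 ≤ dj ∧ dj ≤ 2 := by
    unfold AdjOff at h
    simp only at h
    rcases h with ⟨-, hq⟩ | ⟨-, hq⟩ | ⟨h0, hq⟩
    · rw [sub_zero, sub_zero] at hq; exact Qf_eq_one_bounds hq
    · rcases hq with ⟨-, hq⟩ | ⟨-, hq⟩ <;> rw [sub_zero, sub_zero] at hq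
      · exact Qf_lin_bounds hm hq
      · exact Qf_lin_bounds hp hq
    · rcases hq with ⟨-, hq⟩ | ⟨-, hq⟩ <;> rw [zero_sub, zero_sub] at hq
      · have := Qf_lin_bounds (x := -di) (y := -dj) hm hq
        omega
      · have := Qf_lin_bounds (x := -di) (y := -dj) hp hq
        omega
  simp only [Finset.mem_product, Finset.mem_Icc]
  omega

/-- **Face-sharing tetrahedra of an ideal Barlow stacking are stacked vertically.**  If
`p₁ p₂ p₃` is a unit triangle of `barlowStacking a (a√(2/3)) s` and `q ≠ q'` are two points of the
stacking at distance `a` from all three, then `q − q' = ±2h e₃` (`h = a√(2/3)`): the shared face is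
horizontal, lies in an h-layer (`s (k−1) + s k = 0`), and the two tetrahedra sit above and below it.
Proof: Barlow coordinates; neighbours are one layer away at most (`abs_layer_sub_le_one`); distances
`a` become the integer relation `AdjOff` (`dist_offPt_eq_iff`); a `decide` over the `12⁴` offset
quadruples (`bipyramid_core`). -/
theorem barlow_bipyramid_vertical (ha : 0 < a) (hs : IsHaggSeq s) {p₁ p₂ p₃ q q' : E3}
    (h₁ : p₁ ∈ barlowStacking a hh s) (h₂ : p₂ ∈ barlowStacking a hh s)
    (h₃ : p₃ ∈ barlowStacking a hh s) (hq : q ∈ barlowStacking a hh s)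
    (hq' : q' ∈ barlowStacking a hh s)
    (d12 : dist p₁ p₂ = a) (d13 : dist p₁ p₃ = a) (d23 : dist p₂ p₃ = a)
    (dq1 : dist q p₁ = a) (dq2 : dist q p₂ = a) (dq3 : dist q p₃ = a)
    (dq'1 : dist q' p₁ = a) (dq'2 : dist q' p₂ = a) (dq'3 : dist q' p₃ = a) (hne : q ≠ q') :
    q - q' = (2 : ℝ) • layerNormal hh ∨ q' - q = (2 : ℝ) • layerNormal hh := by
  obtain ⟨k, i, j, rfl⟩ := h₁
  obtain ⟨k₂, i₂, j₂, rfl⟩ := h₂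
  obtain ⟨k₃, i₃, j₃, rfl⟩ := h₃
  obtain ⟨kq, iq, jq, rfl⟩ := hq
  obtain ⟨kq', iq', jq', rfl⟩ := hq'
  have b2 := abs_layer_sub_le_one (s := s) ha d12
  have b3 := abs_layer_sub_le_one (s := s) ha d13
  have bq := abs_layer_sub_le_one (s := s) ha dq1
  have bq' := abs_layer_sub_le_one (s := s) ha dq'1
  -- offsets
  set d₂ : ℤ × ℤ × ℤ := (k₂ - k, i₂ - i, j₂ - j) with hd₂
  set d₃ : ℤ × ℤ × ℤ := (k₃ - k, i₃ - i, j₃ - j) with hd₃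
  set e : ℤ × ℤ × ℤ := (kq - k, iq - i, jq - j) with he
  set e' : ℤ × ℤ × ℤ := (kq' - k, iq' - i, jq' - j) with he'
  have hd0 : ((0, 0, 0) : ℤ × ℤ × ℤ).1 = -1 ∨ ((0, 0, 0) : ℤ × ℤ × ℤ).1 = 0 ∨ ((0, 0, 0) : ℤ × ℤ × ℤ).1 = 1 := by simp
  have hd₂1 : d₂.1 = -1 ∨ d₂.1 = 0 ∨ d₂.1 = 1 := by simp only [hd₂]; rw [abs_le] at b2; omega
  have hd₃1 : d₃.1 = -1 ∨ d₃.1 = 0 ∨ d₃.1 = 1 := by simp only [hd₃]; rw [abs_le] at b3; omega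
  have he1 : e.1 = -1 ∨ e.1 = 0 ∨ e.1 = 1 := by simp only [he]; rw [abs_le] at bq; omega
  have he'1 : e'.1 = -1 ∨ e'.1 = 0 ∨ e'.1 = 1 := by simp only [he']; rw [abs_le] at bq'; omega
  have P0 : barlowPos a hh s k i j = offPt a s k i j (0, 0, 0) := by simp [offPt]
  rw [offPt_eq k i j k₂ i₂ j₂] at d12 d23 dq2 dq'2
  rw [offPt_eq k i j k₃ i₃ j₃] at d13 d23 dq3 dq'3
  rw [offPt_eq k i j kq iq jq] at dq1 dq2 dq3 hne ⊢
  rw [offPt_eq k i j kq' iq' jq'] at dq'1 dq'2 dq'3 hne ⊢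
  rw [P0] at d12 d13 dq1 dq'1
  change dist (offPt a s k i j (0,0,0)) (offPt a s k i j d₂) = a at d12
  change dist (offPt a s k i j (0,0,0)) (offPt a s k i j d₃) = a at d13
  change dist (offPt a s k i j d₂) (offPt a s k i j d₃) = a at d23
  change dist (offPt a s k i j e) (offPt a s k i j (0,0,0)) = a at dq1
  change dist (offPt a s k i j e) (offPt a s k i j d₂) = a at dq2
  change dist (offPt a s k i j e) (offPt a s k i j d₃) = a at dq3
  change dist (offPt a s k i j e') (offPt a s k i j (0,0,0)) = a at dq'1
  change dist (offPt a s k i j e') (offPt a s k i j d₂) = a at dq'2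
  change dist (offPt a s k i j e') (offPt a s k i j d₃) = a at dq'3
  change offPt a s k i j e ≠ offPt a s k i j e' at hne
  change offPt a s k i j e - offPt a s k i j e' = _ ∨ offPt a s k i j e' - offPt a s k i j e = _
  set σm := s (k - 1) with hσm
  set σp := s k with hσp
  have hm : σm = 1 ∨ σm = -1 := hs (k - 1)
  have hp : σp = 1 ∨ σp = -1 := hs k
  have A := fun (d e : ℤ × ℤ × ℤ) hd he => (dist_offPt_eq_iff ha hs k i j d e hd he).1
  have a12 := A _ _ hd0 hd₂1 d12
  have a13 := A _ _ hd0 hd₃1 d13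
  have a23 := A _ _ hd₂1 hd₃1 d23
  have aq1 := A _ _ he1 hd0 dq1
  have aq2 := A _ _ he1 hd₂1 dq2
  have aq3 := A _ _ he1 hd₃1 dq3
  have aq'1 := A _ _ he'1 hd0 dq'1
  have aq'2 := A _ _ he'1 hd₂1 dq'2
  have aq'3 := A _ _ he'1 hd₃1 dq'3
  -- adjacency to the origin is symmetric in the needed direction: we need `AdjOff d 0` for d₂ d₃
  have symm : ∀ d : ℤ × ℤ × ℤ, (d.1 = -1 ∨ d.1 = 0 ∨ d.1 = 1) →
      AdjOff σm σp (0, 0, 0) d → AdjOff σm σp d (0, 0, 0) := by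
    intro d hd h
    have := (dist_offPt_eq_iff ha hs k i j (0,0,0) d hd0 hd).2 h
    rw [dist_comm] at this
    exact (dist_offPt_eq_iff ha hs k i j d (0,0,0) hd hd0).1 this
  have m2 := mem_nbrOff_of_adjOff hm hp hd₂1 (symm _ hd₂1 a12)
  have m3 := mem_nbrOff_of_adjOff hm hp hd₃1 (symm _ hd₃1 a13)
  have mq := mem_nbrOff_of_adjOff hm hp he1 aq1
  have mq' := mem_nbrOff_of_adjOff hm hp he'1 aq'1
  have hne' : e ≠ e' := fun h => hne (by rw [h])
  obtain ⟨hsame, hlay, hσ⟩ := bipyramid_core σm σp hm hp d₂ m2 d₃ m3 e mq e' mq' a23 aq2 aq3 aq'2 aq'3 hne'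
  -- the label difference vanishes
  have hL : haggLabel s (k + 1) = haggLabel s (k + -1) := by
    have h1 := haggLabel_succ s k
    have h2 := haggLabel_succ s (k - 1)
    rw [sub_add_cancel] at h2
    rw [show k + -1 = k - 1 by ring]
    have : s (k - 1) + s k = 0 := hσ
    omega
  obtain ⟨ek, ei, ej⟩ := e
  obtain ⟨ek', ei', ej'⟩ := e'
  simp only [Prod.mk.injEq] at hsame
  obtain ⟨rfl, rfl⟩ := hsame
  simp only at hlay
  rcases hlay with ⟨rfl, rfl⟩ | ⟨rfl, rfl⟩
  · left
    simp only [offPt, barlowPos, hL]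
    push_cast
    module
  · right
    simp only [offPt, barlowPos, hL]
    push_cast
    module

end Bipyramid


/-! ### Barlow distance spectrum near `a` -/

section Spectrum

variable {a : ℝ} {s : ℤ → ℤ}

local notation "hh" => a * Real.sqrt (2 / 3)

/-- Refinement of `barlow_dist_sq_trichotomy`: squared Barlow distances are `0`, `a²`, `2a²` or
`≥ 8a²/3`. -/
theorem barlow_dist_sq_spectrum (ha : 0 < a) (hs : IsHaggSeq s) {z z' : E3}
    (hz : z ∈ barlowStacking a hh s) (hz' : z' ∈ barlowStacking a hh s) :
    dist z z' ^ 2 = 0 ∨ dist z z' ^ 2 = a ^ 2 ∨ dist z z' ^ 2 = 2 * a ^ 2 ∨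
      8 * a ^ 2 / 3 ≤ dist z z' ^ 2 := by
  have hh2 : (hh) ^ 2 = 2 * a ^ 2 / 3 := hh_sq
  have hhpos : 0 < hh := hh_pos ha
  obtain ⟨k, i, j, rfl⟩ := hz
  obtain ⟨k', i', j', rfl⟩ := hz'
  have hint : ∀ (E : ℤ) (d : ℝ), 0 ≤ d ^ 2 → d ^ 2 = a ^ 2 * E →
      d ^ 2 = 0 ∨ d ^ 2 = a ^ 2 ∨ d ^ 2 = 2 * a ^ 2 ∨ 8 * a ^ 2 / 3 ≤ d ^ 2 := by
    intro E d hd hE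
    have ha2 : 0 < a ^ 2 := by positivity
    rcases (show E ≤ 0 ∨ E = 1 ∨ E = 2 ∨ 3 ≤ E by omega) with h0 | h1 | h2 | h3
    · left; have : (E : ℝ) ≤ 0 := (by exact_mod_cast h0); nlinarith
    · right; left; rw [hE, h1]; push_cast; ring
    · right; right; left; rw [hE, h2]; push_cast; ring
    · right; right; right; rw [hE]; have : (3 : ℝ) ≤ E := (by exact_mod_cast h3); nlinarith
  wlog hkk : k' ≤ k generalizing k i j k' i' j'
  · have := this k' i' j' k i j (le_of_not_ge hkk)
    rwa [dist_comm] at this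
  rcases hkk.lt_or_eq with hlt | heq
  · rcases (show k = k' + 1 ∨ k' + 2 ≤ k by omega) with h1 | h2
    · subst h1
      refine hint (((i - i') ^ 2 + (i - i') * (j - j') + (j - j') ^ 2 +
        s k' * ((i - i') + (j - j'))) + 1) _ (sq_nonneg _) ?_
      rw [dist_sq_succLayer a _ hs, hh2]; push_cast; ring
    · right; right; right
      have h4 := lt_dist_of_two_le_layers (s := s) ha (K := k) (K' := k')
        (by rw [abs_of_nonneg (by omega)]; omega) i j i' j'
      have h3 := PiLp.dist_apply_le (barlowPos a hh s k i j) (barlowPos a hh s k' i' j') 2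
      rw [barlowPos_apply_two, barlowPos_apply_two, Real.dist_eq, ← sub_mul, abs_mul,
        abs_of_pos hhpos] at h3
      have hk2 : (2 : ℝ) ≤ |(k : ℝ) - k'| := by
        rw [← Int.cast_sub, ← Int.cast_abs]
        exact_mod_cast (show (2 : ℤ) ≤ |k - k'| by rw [abs_of_nonneg (by omega)]; omega)
      have h5 : 2 * hh ≤ dist (barlowPos a hh s k i j) (barlowPos a hh s k' i' j') :=
        le_trans (by nlinarith) h3
      nlinarith [h5, hh2]
  · subst heq
    refine hint ((i - i') ^ 2 + (i - i') * (j - j') + (j - j') ^ 2) _ (sq_nonneg _) ?_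
    rw [dist_sq_sameLayer]

/-- **Forcing**: a Barlow distance strictly between `a/2` and `√2·a` equals `a`. -/
theorem barlow_dist_eq_a (ha : 0 < a) (hs : IsHaggSeq s) {z z' : E3}
    (hz : z ∈ barlowStacking a hh s) (hz' : z' ∈ barlowStacking a hh s)
    (h1 : (a / 2) ^ 2 < dist z z' ^ 2) (h2 : dist z z' ^ 2 < 2 * a ^ 2) : dist z z' = a := by
  rcases barlow_dist_sq_spectrum ha hs hz hz' with h | h | h | h
  · nlinarith [sq_nonneg a]
  · exact (sq_eq_sq₀ dist_nonneg ha.le).1 h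
  · linarith
  · nlinarith [sq_nonneg a]

end Spectrum

/-! ### The T-junction ball (integer coordinates ×3, `nn² = 18`) -/

/-- The eleven distinguished sites: the centre `c = 3·(0,0,−4)`, the bipyramid `B₁` across the twin
plane `P₁ = {x+y+z=0}` (triangle `p₁ p₂ p₃ ⊂ P₁`, parent apex `q₀ ∈ O₁`, twin apex `q ∈ O`), and the
bipyramid `B₂` across `P₂ = {x+y−z=0}` (twin apex in `O₂`). -/
def twinFront : List P3 :=
  [(0, 0, -12), (3, 3, -6), (6, 3, -9), (6, 0, -6), (3, 0, -9), (7, 4, -5),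
    (-3, -3, -6), (-6, -3, -9), (-6, 0, -6), (-3, 0, -9), (-7, -4, -5)]

/-- The three grains (×3): `O₁ = Λ ∩ {σ₁ ≤ 0 ≤ σ₂}`, `O = R₁(Λ ∩ {σ₁ < 0})` (`3p − 2σ₁(1,1,1)`),
`O₂ = R₂(Λ ∩ {σ₂ > 0, 3σ₁ < 2σ₂})` (`3p − 2σ₂(1,1,−1)`), `Λ` = fcc (`x+y+z` even), kept within
squared distance `R2` of the centre. -/
def genTwin (B : ℕ) (R2 : ℤ) : List P3 :=
  (List.range (2 * B + 1)).flatMap fun i => (List.range (2 * B + 1)).flatMap fun j =>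
    (List.range (2 * B + 1)).flatMap fun k =>
      let x : ℤ := (i : ℤ) - B
      let y : ℤ := (j : ℤ) - B
      let z : ℤ := (k : ℤ) - B
      if (x + y + z) % 2 ≠ 0 then [] else
        ((if x + y + z ≤ 0 ∧ 0 ≤ x + y - z ∧ sqN3 (3 * x, 3 * y, 3 * z) (0, 0, -12) ≤ R2 then
            [(3 * x, 3 * y, 3 * z)] else []) ++
        (if x + y + z < 0 ∧ sqN3 (3 * x - 2 * (x + y + z), 3 * y - 2 * (x + y + z), 3 * z - 2 * (x + y + z)) (0, 0, -12) ≤ R2 then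
            [(3 * x - 2 * (x + y + z), 3 * y - 2 * (x + y + z), 3 * z - 2 * (x + y + z))] else []) ++
        (if 0 < x + y - z ∧ 3 * (x + y + z) < 2 * (x + y - z) ∧
              sqN3 (3 * x - 2 * (x + y - z), 3 * y - 2 * (x + y - z), 3 * z + 2 * (x + y - z)) (0, 0, -12) ≤ R2 then
            [(3 * x - 2 * (x + y - z), 3 * y - 2 * (x + y - z), 3 * z + 2 * (x + y - z))] else []))

/-- The `723`-site T-junction ball: the eleven distinguished sites first, then the rest. -/
def twinArr : Array P3 := (twinFront ++ ((genTwin 9 450).filter fun p => p ∉ twinFront)).toArray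

/-- The table. -/
@[irreducible] def Ttw : Fin 723 → P3 := fun j => twinArr.getD j.val (0, 0, 0)

/-- COMPUTATIONAL CERTIFICATE (`native_decide`): the distinguished rows, min-square `18`
everywhere, and charge-freeness (Bool form) of the `133` rows within `2.8·nn` of the centre
(`sqN3 ≤ 141 < (14/5)²·18`). -/
theorem Ttw_cert :
    Ttw 0 = (0, 0, -12) ∧ Ttw 1 = (3, 3, -6) ∧ Ttw 2 = (6, 3, -9) ∧ Ttw 3 = (6, 0, -6) ∧
    Ttw 4 = (3, 0, -9) ∧ Ttw 5 = (7, 4, -5) ∧ Ttw 6 = (-3, -3, -6) ∧ Ttw 7 = (-6, -3, -9) ∧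
    Ttw 8 = (-6, 0, -6) ∧ Ttw 9 = (-3, 0, -9) ∧ Ttw 10 = (-7, -4, -5) ∧
    minSqB Ttw (fun _ => 18) = true ∧
    ((List.finRange 723).all fun j =>
      !(decide (sqN3 (Ttw 0) (Ttw j) ≤ 141)) || cfB Ttw (fun _ => 18) j) = true := by
  native_decide

/-- `intVec` is additive. -/
theorem intVec_add (v w : Fin 3 → ℤ) : intVec (v + w) = intVec v + intVec w := by
  ext i; simp [intVec]

/-- **The double-twin T-junction refutes hypothesis radius `14/5`**: `¬ SLP (14/5) 3 (1/6)`.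
The `723`-site configuration `Ttw` (three fcc grains `O₁, O, O₂` pairwise twinned across
`P₁ = {x+y+z=0}` and `P₂ = {x+y−z=0}`, which meet at `70.5°` along the line through the origin;
centre `c = (0,0,−12)` at distance `2√2·nn` from the junction) has every site within `2.8·nn`
of `c` charge-free at `η = 1/100` (`Ttw_cert`), yet its `3·nn`-ball is not `nn/6`-matchable to any
Barlow stacking: it contains a bipyramid (two face-sharing tetrahedra) across `P₁` with axis
`(4,4,4)` and one across `P₂` with axis `(−4,−4,4)`; an `nn/6`-matching sends each to an EXACT
Barlow bipyramid (`barlow_dist_eq_a`), whose axes are both `±2h e₃` (`barlow_bipyramid_vertical`),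
so the two configuration axes would agree up to sign within `2·nn/3 = 2√2`, whereas
`|(4,4,4) − (−4,−4,4)| = 8√2` and `|(4,4,4) + (−4,−4,4)| = 8`.  So the charge-free ball of the crux
must have radius `> 2.8·nn` (the T-junction family cannot do better than `2√2 ≈ 2.83`, j005226). -/
theorem softLayerPropagation_false_radius_twin : ¬ SLP (14 / 5) 3 (1 / 6) := by
  intro H
  obtain ⟨h0, h1, h2, h3, h4, h5, h6, h7, h8, h9, h10, hminB, hcfB⟩ := Ttw_cert
  have hmin : IsMinSq (toVec ∘ Ttw) (fun _ => 18) := isMinSq_of_minSqB hminB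
  clear hminB
  have hcf : ∀ j : Fin 723, sqN3 (Ttw 0) (Ttw j) ≤ 141 →
      ChargeFreeInt (toVec ∘ Ttw) (fun _ => 18) j := by
    intro j hj
    have hall := List.all_eq_true.1 hcfB j (List.mem_finRange j)
    rw [Bool.or_eq_true, Bool.not_eq_true', decide_eq_false_iff_not] at hall
    rcases hall with hno | hcf
    · exact absurd hj hno
    · exact chargeFreeInt_of_cfB hcf
  clear hcfB
  have hnn : nearestDist (cfg 1 (toVec ∘ Ttw)) 0 = Real.sqrt 18 := by
    rw [nearestDist_cfg (c := 1) hmin]; simp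
  set y : Fin 723 → E3 := cfg 1 (toVec ∘ Ttw) with hy
  set a := nearestDist y 0 with ha_def
  have ha2 : a ^ 2 = 18 := by rw [hnn, Real.sq_sqrt (by norm_num)]
  have ha0 : 0 < a := by rw [hnn]; positivity
  have ha_lt : a < 4.25 := by nlinarith [sq_nonneg (a - 4.25)]
  have ha_gt : 4.24 < a := by nlinarith [sq_nonneg (a + 4.24)]
  have hdist : ∀ j k, dist (y j) (y k) = Real.sqrt (sqN3 (Ttw j) (Ttw k)) := by
    intro j k
    rw [hy, dist_cfg, abs_one, one_mul, Function.comp_apply, Function.comp_apply,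
      sqNormInt_toVec_sub]
  have hdist' : ∀ j k, sqN3 (Ttw j) (Ttw k) = 18 → dist (y j) (y k) = a := by
    intro j k h; rw [hdist, h]; push_cast; exact hnn.symm
  -- hypothesis of `SLP (14/5)`
  have hball : ∀ j, dist (y 0) (y j) ≤ 14 / 5 * a → IsChargeFree (1 / 100) y j := by
    intro j hj
    have hj' : sqN3 (Ttw 0) (Ttw j) ≤ 141 := by
      rw [hdist, hnn, show (14 / 5 : ℝ) * Real.sqrt 18 = Real.sqrt (3528 / 25) by
          rw [show (3528 / 25 : ℝ) = (14 / 5) ^ 2 * 18 by norm_num, Real.sqrt_mul (by norm_num),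
            Real.sqrt_sq (by norm_num)],
        Real.sqrt_le_sqrt_iff (by norm_num)] at hj
      have : (sqN3 (Ttw 0) (Ttw j) : ℝ) < 142 := by linarith
      have : sqN3 (Ttw 0) (Ttw j) < 142 := by exact_mod_cast this
      omega
    exact (isChargeFree_cfg_iff one_ne_zero hmin j).2 (hcf j hj')
  obtain ⟨s, g, hs, hcl1, -⟩ := H (1 / 100) (by norm_num) le_rfl 723 y 0 hball
  -- forcing exact unit distances between matched points
  have force : ∀ (u v : Fin 723) (zu zv : E3), sqN3 (Ttw u) (Ttw v) = 18 →
      zu ∈ barlowStacking a (a * Real.sqrt (2 / 3)) s → zv ∈ barlowStacking a (a * Real.sqrt (2 / 3)) s →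
      dist (y u) (g zu) ≤ 1 / 6 * a → dist (y v) (g zv) ≤ 1 / 6 * a → dist zu zv = a := by
    intro u v zu zv huv hzu hzv eu ev
    have duv := hdist' u v huv
    have hup : dist zu zv ≤ a + a / 3 := by
      rw [← g.dist_map]
      calc dist (g zu) (g zv) ≤ dist (g zu) (y u) + dist (y u) (y v) + dist (y v) (g zv) :=
            dist_triangle4 _ _ _ _
        _ ≤ 1 / 6 * a + a + 1 / 6 * a := by rw [dist_comm (g zu), duv]; linarith
        _ = a + a / 3 := by ring
    have hlo : a - a / 3 ≤ dist zu zv := by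
      rw [← g.dist_map]
      have := dist_triangle4 (y u) (g zu) (g zv) (y v)
      rw [dist_comm (g zv) (y v), duv] at this
      linarith
    have hd0 : 0 ≤ dist zu zv := dist_nonneg
    refine barlow_dist_eq_a ha0 hs hzu hzv ?_ ?_
    · have h23 : 2 * a / 3 ≤ dist zu zv := by linarith
      calc (a / 2) ^ 2 < (2 * a / 3) ^ 2 := by nlinarith [ha0]
        _ ≤ dist zu zv ^ 2 := pow_le_pow_left₀ (by positivity) h23 2
    · have h43 : dist zu zv ≤ 4 * a / 3 := by linarith
      calc dist zu zv ^ 2 ≤ (4 * a / 3) ^ 2 := pow_le_pow_left₀ hd0 h43 2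
        _ < 2 * a ^ 2 := by nlinarith [ha0]
  have ne_of_far : ∀ (u v : Fin 723) (zu zv : E3), sqN3 (Ttw u) (Ttw v) = 48 →
      dist (y u) (g zu) ≤ 1 / 6 * a → dist (y v) (g zv) ≤ 1 / 6 * a → zu ≠ zv := by
    intro u v zu zv huv eu ev heq
    subst heq
    have duv : dist (y u) (y v) = Real.sqrt 48 := by rw [hdist, huv]; norm_num
    have h48 : (6 : ℝ) < Real.sqrt 48 := by
      rw [show (6 : ℝ) = Real.sqrt 36 by rw [show (36:ℝ) = 6 ^ 2 by norm_num, Real.sqrt_sq (by norm_num)]]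
      exact Real.sqrt_lt_sqrt (by norm_num) (by norm_num)
    have := dist_triangle (y u) (g zu) (y v)
    rw [dist_comm (g zu) (y v), duv] at this
    linarith
  -- the ten bipyramid sites are within 3a of the centre
  have within : ∀ j, sqN3 (Ttw 0) (Ttw j) ≤ 162 → dist (y 0) (y j) ≤ 3 * a := by
    intro j hj
    rw [hdist, hnn, show (3 : ℝ) * Real.sqrt 18 = Real.sqrt 162 by
      rw [show (162 : ℝ) = 3 ^ 2 * 18 by norm_num, Real.sqrt_mul (by norm_num), Real.sqrt_sq (by norm_num)]]
    exact Real.sqrt_le_sqrt (by exact_mod_cast hj)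
  obtain ⟨z1, m1, e1⟩ := hcl1 1 (within 1 (by rw [h0, h1]; decide))
  obtain ⟨z2, m2, e2⟩ := hcl1 2 (within 2 (by rw [h0, h2]; decide))
  obtain ⟨z3, m3, e3⟩ := hcl1 3 (within 3 (by rw [h0, h3]; decide))
  obtain ⟨z4, m4, e4⟩ := hcl1 4 (within 4 (by rw [h0, h4]; decide))
  obtain ⟨z5, m5, e5⟩ := hcl1 5 (within 5 (by rw [h0, h5]; decide))
  obtain ⟨z6, m6, e6⟩ := hcl1 6 (within 6 (by rw [h0, h6]; decide))
  obtain ⟨z7, m7, e7⟩ := hcl1 7 (within 7 (by rw [h0, h7]; decide))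
  obtain ⟨z8, m8, e8⟩ := hcl1 8 (within 8 (by rw [h0, h8]; decide))
  obtain ⟨z9, m9, e9⟩ := hcl1 9 (within 9 (by rw [h0, h9]; decide))
  obtain ⟨z10, m10, e10⟩ := hcl1 10 (within 10 (by rw [h0, h10]; decide))
  -- bipyramid 1: triangle 1 2 3, apices 5 (q) and 4 (q₀); bipyramid 2: triangle 6 7 8, apices 10 and 9
  have A1 := barlow_bipyramid_vertical ha0 hs m1 m2 m3 m5 m4
    (force 1 2 z1 z2 (by rw [h1, h2]; decide) m1 m2 e1 e2)
    (force 1 3 z1 z3 (by rw [h1, h3]; decide) m1 m3 e1 e3)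
    (force 2 3 z2 z3 (by rw [h2, h3]; decide) m2 m3 e2 e3)
    (force 5 1 z5 z1 (by rw [h5, h1]; decide) m5 m1 e5 e1)
    (force 5 2 z5 z2 (by rw [h5, h2]; decide) m5 m2 e5 e2)
    (force 5 3 z5 z3 (by rw [h5, h3]; decide) m5 m3 e5 e3)
    (force 4 1 z4 z1 (by rw [h4, h1]; decide) m4 m1 e4 e1)
    (force 4 2 z4 z2 (by rw [h4, h2]; decide) m4 m2 e4 e2)
    (force 4 3 z4 z3 (by rw [h4, h3]; decide) m4 m3 e4 e3)
    (ne_of_far 5 4 z5 z4 (by rw [h5, h4]; decide) e5 e4)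
  have A2 := barlow_bipyramid_vertical ha0 hs m6 m7 m8 m10 m9
    (force 6 7 z6 z7 (by rw [h6, h7]; decide) m6 m7 e6 e7)
    (force 6 8 z6 z8 (by rw [h6, h8]; decide) m6 m8 e6 e8)
    (force 7 8 z7 z8 (by rw [h7, h8]; decide) m7 m8 e7 e8)
    (force 10 6 z10 z6 (by rw [h10, h6]; decide) m10 m6 e10 e6)
    (force 10 7 z10 z7 (by rw [h10, h7]; decide) m10 m7 e10 e7)
    (force 10 8 z10 z8 (by rw [h10, h8]; decide) m10 m8 e10 e8)
    (force 9 6 z9 z6 (by rw [h9, h6]; decide) m9 m6 e9 e6)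
    (force 9 7 z9 z7 (by rw [h9, h7]; decide) m9 m7 e9 e7)
    (force 9 8 z9 z8 (by rw [h9, h8]; decide) m9 m8 e9 e8)
    (ne_of_far 10 9 z10 z9 (by rw [h10, h9]; decide) e10 e9)
  -- the two Barlow axes are parallel: z5 - z4 = ε (z10 - z9)
  have hpar : z5 - z4 = z10 - z9 ∨ z5 - z4 = -(z10 - z9) := by
    rcases A1 with hA | hA <;> rcases A2 with hB | hB
    · left; rw [hA, hB]
    · right; rw [hA, ← hB, neg_sub]
    · right; rw [hB, ← hA, neg_sub]
    · left; rw [← neg_sub z4 z5, hA, ← neg_sub z9 z10, hB]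
  -- the configuration axes
  have V1 : y 5 - y 4 = intVec ![4, 4, 4] := by
    rw [hy]; simp only [cfg, Function.comp_apply, h5, h4, one_smul, intVec_sub]
    congr 1; ext i; fin_cases i <;> simp [toVec]
  have V2 : y 10 - y 9 = intVec ![-4, -4, 4] := by
    rw [hy]; simp only [cfg, Function.comp_apply, h10, h9, one_smul, intVec_sub]
    congr 1; ext i; fin_cases i <;> simp [toVec]
  -- images of the Barlow axes under g
  have G1 : g z5 - g z4 = g.linearIsometryEquiv (z5 - z4) := by
    have h := g.map_vsub z5 z4
    simp only [vsub_eq_sub] at h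
    exact h.symm
  have G2 : g z10 - g z9 = g.linearIsometryEquiv (z10 - z9) := by
    have h := g.map_vsub z10 z9
    simp only [vsub_eq_sub] at h
    exact h.symm
  have close1 : ‖(y 5 - y 4) - (g z5 - g z4)‖ ≤ a / 3 := by
    calc ‖(y 5 - y 4) - (g z5 - g z4)‖ = ‖(y 5 - g z5) - (y 4 - g z4)‖ := by congr 1; abel
      _ ≤ ‖y 5 - g z5‖ + ‖y 4 - g z4‖ := norm_sub_le _ _
      _ ≤ 1 / 6 * a + 1 / 6 * a := by rw [← dist_eq_norm, ← dist_eq_norm]; exact add_le_add e5 e4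
      _ = a / 3 := by ring
  have close2 : ‖(y 10 - y 9) - (g z10 - g z9)‖ ≤ a / 3 := by
    calc ‖(y 10 - y 9) - (g z10 - g z9)‖ = ‖(y 10 - g z10) - (y 9 - g z9)‖ := by congr 1; abel
      _ ≤ ‖y 10 - g z10‖ + ‖y 9 - g z9‖ := norm_sub_le _ _
      _ ≤ 1 / 6 * a + 1 / 6 * a := by rw [← dist_eq_norm, ← dist_eq_norm]; exact add_le_add e10 e9
      _ = a / 3 := by ring
  have n1 : ‖intVec ![4, 4, 4] - intVec ![-4, -4, 4]‖ = Real.sqrt 128 := by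
    have hc : sqNormInt (![4, 4, 4] - ![-4, -4, 4]) = 128 := by decide
    rw [intVec_sub, norm_intVec, hc, show ((128 : ℤ) : ℝ) = 128 by norm_num]
  have n2 : ‖intVec ![4, 4, 4] + intVec ![-4, -4, 4]‖ = 8 := by
    have hc : sqNormInt (![4, 4, 4] + ![-4, -4, 4]) = 64 := by decide
    rw [← intVec_add, norm_intVec, hc, show ((64 : ℤ) : ℝ) = 8 ^ 2 by norm_num]
    exact Real.sqrt_sq (by norm_num)
  have hs128 : (11 : ℝ) < Real.sqrt 128 := by
    rw [show (11 : ℝ) = Real.sqrt 121 by rw [show (121:ℝ) = 11 ^ 2 by norm_num, Real.sqrt_sq (by norm_num)]]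
    exact Real.sqrt_lt_sqrt (by norm_num) (by norm_num)
  rcases hpar with hE | hE
  · -- axes equal: V1 - V2 is within 2a/3 of 0
    have : ‖(y 5 - y 4) - (y 10 - y 9)‖ ≤ a / 3 + a / 3 := by
      calc ‖(y 5 - y 4) - (y 10 - y 9)‖
          = ‖((y 5 - y 4) - (g z5 - g z4)) - ((y 10 - y 9) - (g z10 - g z9))‖ := by
            rw [G1, G2, hE]; congr 1; abel
        _ ≤ ‖(y 5 - y 4) - (g z5 - g z4)‖ + ‖(y 10 - y 9) - (g z10 - g z9)‖ := norm_sub_le _ _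
        _ ≤ a / 3 + a / 3 := add_le_add close1 close2
    rw [V1, V2, n1] at this
    linarith
  · have : ‖(y 5 - y 4) + (y 10 - y 9)‖ ≤ a / 3 + a / 3 := by
      calc ‖(y 5 - y 4) + (y 10 - y 9)‖
          = ‖((y 5 - y 4) - (g z5 - g z4)) + ((y 10 - y 9) - (g z10 - g z9))‖ := by
            rw [G1, G2, hE, map_neg]; congr 1; abel
        _ ≤ ‖(y 5 - y 4) - (g z5 - g z4)‖ + ‖(y 10 - y 9) - (g z10 - g z9)‖ := norm_add_le _ _
        _ ≤ a / 3 + a / 3 := add_le_add close1 close2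
    rw [V1, V2, n2] at this
    linarith

end Twin

end Summit.AtomisticToContinuum.Crystallization.Cruxes.SoftLayerPropagation.Disproof

end
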